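import Literature.AlgebraicGeometry.HodgeTheory.FermatHodgeCharactersPrimePow
import HarnessLib

/-!
# Koblitz–Ogus relations for the Hodge multisets of level `24p` (Shioda 1982 §3 / Aoki 1983 Prop. 2.2, via Deligne LNM 900 Rem. 7.16 (a))

Topic `Literature/AlgebraicGeometry/Shioda1982`. THEOREMS (no named fact, no `sorry`): the first half of the level `m = 24p` member of
the series `PicardNumber*.lean` / `HodgeQuadruples*Prime.lean` (indecomposable Hodge quadruples and the Picard number of the Fermat
surface `X²ₘ`, T. Shioda, *On the Picard number of a Fermat surface*, J. Fac. Sci. Univ. Tokyo IA **28** (1982) 725–734; the second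
half, the classification of the pair-free Hodge `4`-multisets of level `24p` by transfer to the tree's level-`12p` theorem
`classify_hodgeMultiset_twelvePrime`, is `HodgeQuadruplesTwentyFourPrime.lean`): five explicit, `p`-independent families of LINEAR
RELATIONS satisfied by the multiplicity function of every Hodge multiset (`FermatCharacter.IsHodgeMultiset`, Shioda's condition
`Σ⟨t aᵢ⟩` constant [Shioda1979PJA, §1 (2)]) of level `24p`, `p ≥ 5` prime, in the Chinese-remainder coordinates `ℤ/24p ≅ ℤ/24 × ℤ/p`,
`w ↔ (u, c)` (**`crtPt24`**). Write `ô(u, c) = #_{(u,c)}(s) − #_{(−u,−c)}(s)` (**`oddCt`**) and, for a function `χ` on `ℤ/24`,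
`U_χ(c) = Σ_{u ∈ (ℤ/24)ˣ} χ(u) ô(u, c)`, `E_χ(c) = Σ_{e ∈ (ℤ/12)ˣ} χ(e) ô(2e, c)`, `T_χ(c) = Σ_{e ∈ (ℤ/8)ˣ} χ(e) ô(3e, c)`; `χ₄`, `χ₃`,
`χ₈ = (2/·)`, `χ₋₈ = (−2/·)` the Dirichlet characters of conductors `4, 3, 8, 8`. For every `b ≢ 0`, `b′ ≢ 0 (mod p)`:

* **`relPsi_twentyFourPrime`** (the even character `ψ = χ₃χ₋₈` of conductor `24`, made odd across the fibres `±b`):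
  `U_ψ(b) = ô(1,b) + ô(5,b) − ô(7,b) − ô(11,b) − ô(13,b) − ô(17,b) + ô(19,b) + ô(23,b) = 0`;
* **`relChi8_twentyFourPrime`** (the even character `χ₈` of conductor `8`; Euler factor at `3`): `U_{χ₈}(b) + U_{χ₈}(3b) + 2T_{χ₈}(3b) = 0`;
* **`gammaChiM8_twentyFourPrime`** (the odd character `χ₋₈`): `Γ_{−8}(b) = U_{χ₋₈}(b) − U_{χ₋₈}(3b) + 2T_{χ₋₈}(3b)` (**`gammaM8Sum`**)
  is independent of `b ≠ 0`: `Γ_{−8}(b) = Γ_{−8}(b′)`;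
* **`gammaChi4_twentyFourPrime`** (the odd character `χ₄`): `Γ₄(b) = U₄(b) + U₄(3b) + 2E₄(2b) + 2E₄(6b) + 2T₄(3b) + 4S₄(6b)`
  (**`gamma4Sum`**; `S₄(c) = ô(6,c) − ô(18,c)`) is independent of `b ≠ 0`;
* **`gammaChi3_twentyFourPrime`** (the odd character `χ₃`): `Γ₃(b) = U₃(b) + U₃(2b) + 2E₃(2b) + 2E₃(4b) + 4Q₃(4b) + 4Q₃(8b) + 4O₃(8b)`
  (**`gamma3Sum`**; `Q₃(c) = ô(4,c) − ô(20,c)`, `O₃(c) = ô(8,c) − ô(16,c)`) is independent of `b ≠ 0`.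

PROOF (this formalisation's; the printed route is Shioda's inductive structure / Aoki's Prop. 2.2): by the tree's PROVED
`KoblitzOgus.hodge_eq_combination` [Deligne1982HodgeCycles, Rem. 7.16 (a)] the multiplicity function of a Hodge multiset of level `N`
is a `ℚ`-combination of reflection vectors `e_a + e_{−a}` and distribution vectors `D_{M,z} = 𝟙[· ≡ z (M)] − 𝟙[· = (N/M) z]`, `M ∣ N`;
the five functionals are odd and annihilate every `D_{M,z}`, `M ∣ 24p` — checked divisor class by divisor class (`M = k`, `k·p` for
the eight `k ∣ 24`) in coordinates, each check a finite computation in `ℤ/24` (`LPsi_koD`, …, `LIV_koD`).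
WHY THESE (the structure behind the guess-free derivation): the linear relations valid for all Hodge multisets of level `m` are exactly
the span `V` of the functions `w ↦ ⟨tw⟩/m − ½` (`t` a unit) — Koblitz–Ogus says that the Hodge multiplicity functions are `V^⊥`'s
annihilator basis —, and `V` decomposes under `(ℤ/m)ˣ` with multiplicity one for each odd character `Ψ = χ ⊗ η` of
`(ℤ/24)ˣ × (ℤ/p)ˣ`; the `Ψ`-component is `Σ_{d ∣ m, f_Ψ ∣ m/d} B_{1,Ψ̄}^{(m/d)} · (φ(m)/φ(m/d)) · Σ_{u ∈ (ℤ/(m/d))ˣ} Ψ(u) g(du)` with the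
generalised Bernoulli numbers `B_{1,Ψ̄}^{(N)} = B_{1,Ψ̄} Π_{ℓ ∣ N, ℓ ∤ f_Ψ} (1 − Ψ̄(ℓ))`; summing over the characters `η` of `(ℤ/p)ˣ` of
the parity complementary to `χ`'s gives, for even `χ` (`ψ`, `χ₈`; `η` odd), relations `= 0` fibre by fibre, and for odd `χ` (`χ₋₈`,
`χ₄`, `χ₃`; `η ≠ 1` even), quantities constant on `b ≠ 0`; the Euler factors `(1 − Ψ̄(3))`, `(1 − Ψ̄(2))` produce the companion
fibres `3b` and `2b, 4b, 8b`. (The three remaining families — `χ₄χ₃` even of conductor `12`: `U_{χ₄χ₃}(b) + 2E_{χ₄χ₃}(2b) = 0`;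
`χ₃χ₈` odd of conductor `24`: `U_{χ₃χ₈}` constant; the trivial `χ`: Shioda's own (unsigned) relation — are not needed downstream and
not included.) Cell `pub-hfermat`, `code/lit/picard/rel24p.py`: all five annihilate every `D_{M,z}` exactly at `p = 5, …, 23`, and
the space of odd annihilators has dimension `4(p − 1)` = the number of odd characters (`scope_relations.py`).
USE (in `HodgeQuadruplesTwentyFourPrime.lean`): `relPsi`, `relChi8`, `gammaChiM8` see only ODD residues and force two odd members
`x, y` of a pair-free Hodge quadruple with `x ∉ pℤ/24p` to satisfy `y = x + 12p` (and exclude the wrong lifts of the level-`12p`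
elements `γ`); `gammaChi4`, `gammaChi3` see the even residues `2e, 4e′, 8e″, 6e‴` and force two even members over opposite fibres
next to two odd members in `pℤ/24p` into the residues `{0, 12} mod 24`.

HONEST FRAMING (cell `pub-hfermat`): explicit algebraic cycles for specific Hodge classes on Fermat/Delsarte varieties; residual open
instances listed; no claim on general Hodge. (Surface classes are algebraic by Lefschetz (1,1); this file proves linear identities
that follow from a printed theorem.)

## References
* [Deligne1982HodgeCycles] P. Deligne, *Hodge cycles on abelian varieties*, LNM 900 (1982), Rem. 7.16 (a) (Koblitz–Ogus), through the
  tree's `Literature.NumberTheory.Transcendental.KoblitzOgus.hodge_eq_combination`.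
* [Aoki1983] N. Aoki, *On some arithmetic problems related to the Hodge cycles on the Fermat varieties*, Math. Ann. 266 (1983) 23–54,
  Prop. 2.2 (relations among Hodge cycles under level change).
* [Shioda1982PicardFermat] T. Shioda, J. Fac. Sci. Univ. Tokyo IA 28 (1982) 725–734, §3 p. 727 (the method), Prop. 4 (Q′) p. 729.
* [Shioda1979PJA] T. Shioda, Proc. Japan Acad. 55A (1979), §1 (2) (the Hodge condition).
-/

namespace Literature.AlgebraicGeometry.Shioda1982

open Finset Multiset Literature.AlgebraicGeometry.HodgeTheory Literature.AlgebraicGeometry.HodgeTheory.FermatCharacter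

section TwentyFourPrime

variable {p : ℕ}

/-! ### `ℤ/24p ≅ ℤ/24 × ℤ/p`: Chinese-remainder coordinates -/

/-- The Chinese-remainder isomorphism `ℤ/24p ≃+* ℤ/24 × ℤ/p`. [folklore] -/
private def crt (h : Nat.Coprime 24 p) : ZMod (24 * p) ≃+* ZMod 24 × ZMod p := ZMod.chineseRemainder h

/-- The residue with coordinates `(e, b)`. [folklore] -/
private def pt (h : Nat.Coprime 24 p) (e : ZMod 24) (b : ZMod p) : ZMod (24 * p) := (crt h).symm (e, b)

/-- First coordinate = residue mod `24`. [folklore] -/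
private theorem crt_fst (h : Nat.Coprime 24 p) [NeZero (24 * p)] (w : ZMod (24 * p)) :
    (crt h w).1 = (w.val : ZMod 24) := by
  conv_lhs => rw [← ZMod.natCast_zmod_val w]
  rw [map_natCast, Prod.fst_natCast]

/-- Second coordinate = residue mod `p`. [folklore] -/
private theorem crt_snd (h : Nat.Coprime 24 p) [NeZero (24 * p)] (w : ZMod (24 * p)) :
    (crt h w).2 = (w.val : ZMod p) := by
  conv_lhs => rw [← ZMod.natCast_zmod_val w]
  rw [map_natCast, Prod.snd_natCast]

/-- `crt (pt e b) = (e, b)`. [folklore] -/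
private theorem crt_pt (h : Nat.Coprime 24 p) (e : ZMod 24) (b : ZMod p) : crt h (pt h e b) = (e, b) :=
  (crt h).apply_symm_apply (e, b)

/-- `pt (crt w) = w`. [folklore] -/
private theorem pt_crt (h : Nat.Coprime 24 p) (w : ZMod (24 * p)) : pt h (crt h w).1 (crt h w).2 = w :=
  (crt h).symm_apply_apply w

/-- `pt` is injective. [folklore] -/
private theorem pt_inj (h : Nat.Coprime 24 p) {e e' : ZMod 24} {b b' : ZMod p} :
    pt h e b = pt h e' b' ↔ e = e' ∧ b = b' := by
  rw [pt, pt, (crt h).symm.injective.eq_iff, Prod.mk.injEq]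

/-- `pt` and negation. [folklore] -/
private theorem neg_pt (h : Nat.Coprime 24 p) (e : ZMod 24) (b : ZMod p) : -pt h e b = pt h (-e) (-b) := by
  rw [pt, pt, ← (crt h).symm.map_neg, Prod.neg_mk]

/-- `pt` and natural multiples. [folklore] -/
private theorem natCast_mul_pt (h : Nat.Coprime 24 p) (k : ℕ) (e : ZMod 24) (b : ZMod p) :
    (k : ZMod (24 * p)) * pt h e b = pt h (k * e) (k * b) := by
  rw [pt, pt, ← nsmul_eq_mul, ← _root_.map_nsmul, Prod.smul_mk, nsmul_eq_mul, nsmul_eq_mul]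

/-! ### The Koblitz–Ogus distribution vectors in Chinese-remainder coordinates -/

/-- The Koblitz–Ogus distribution vector of level `M ∣ N` through `z` (as in `KoblitzOgus.hodge_eq_combination`):
`w ↦ [w ≡ z (mod M)] − [(N/M)·z = w]`. [cite: Deligne1982HodgeCycles, Rem. 7.16 (a)] -/
private def koD (N : ℕ) (M : ℕ) (z w : ZMod N) : ℚ :=
  (if w.val % M = z.val % M then (1 : ℚ) else 0) - (if ((N / M : ℕ) : ZMod N) * z = w then 1 else 0)

/-- The divisors of `24p`. [folklore] -/
private theorem eq_of_dvd_twentyFour_mul_prime (hp : p.Prime) (h5 : 5 ≤ p) {M : ℕ} (hM : M ∣ 24 * p) :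
    M = 1 ∨ M = 2 ∨ M = 3 ∨ M = 4 ∨ M = 6 ∨ M = 8 ∨ M = 12 ∨ M = 24 ∨
      M = p ∨ M = 2 * p ∨ M = 3 * p ∨ M = 4 * p ∨ M = 6 * p ∨ M = 8 * p ∨ M = 12 * p ∨ M = 24 * p := by
  obtain ⟨a, b, ha, hb, rfl⟩ := (Nat.dvd_mul.1 hM)
  have ha' : a = 1 ∨ a = 2 ∨ a = 3 ∨ a = 4 ∨ a = 6 ∨ a = 8 ∨ a = 12 ∨ a = 24 := by
    have := Nat.le_of_dvd (by norm_num) ha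
    interval_cases a <;> simp_all
  rcases (Nat.dvd_prime hp).1 hb with rfl | rfl <;> rcases ha' with rfl | rfl | rfl | rfl | rfl | rfl | rfl | rfl <;> simp

/-- Congruence mod `p` in coordinates. [folklore] -/
private theorem mod_p_iff (h : Nat.Coprime 24 p) [NeZero (24 * p)] (w z : ZMod (24 * p)) :
    w.val % p = z.val % p ↔ (crt h w).2 = (crt h z).2 := by
  rw [crt_snd, crt_snd, ZMod.natCast_eq_natCast_iff']

/-- Congruence mod a divisor `k` of `24` in coordinates. [folklore] -/
private theorem mod_dvd_twentyFour_iff (h : Nat.Coprime 24 p) [NeZero (24 * p)] {k : ℕ} (hk : k ∣ 24)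
    (w z : ZMod (24 * p)) : w.val % k = z.val % k ↔ (crt h w).1.val % k = (crt h z).1.val % k := by
  rw [crt_fst, crt_fst, ZMod.val_natCast, ZMod.val_natCast, Nat.mod_mod_of_dvd _ hk, Nat.mod_mod_of_dvd _ hk]

/-- Congruence mod `k·p`, `k ∣ 24`, in coordinates. [folklore] -/
private theorem mod_dvd_twentyFour_mul_iff (h : Nat.Coprime 24 p) [NeZero (24 * p)] {k : ℕ} (hk : k ∣ 24)
    (w z : ZMod (24 * p)) :
    w.val % (k * p) = z.val % (k * p) ↔ (crt h w).1.val % k = (crt h z).1.val % k ∧ (crt h w).2 = (crt h z).2 := by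
  have hkp : Nat.Coprime k p := Nat.Coprime.coprime_dvd_left hk h
  rw [← mod_dvd_twentyFour_iff h hk, ← mod_p_iff]
  exact (Nat.modEq_and_modEq_iff_modEq_mul hkp).symm

/-- A multiple of `z = pt e b` in coordinates. [folklore] -/
private theorem natCast_mul_eq_pt_iff (h : Nat.Coprime 24 p) (k : ℕ) (ez e : ZMod 24) (bz c : ZMod p) :
    (k : ZMod (24 * p)) * pt h ez bz = pt h e c ↔ (k : ZMod 24) * ez = e ∧ (k : ZMod p) * bz = c := by
  rw [natCast_mul_pt, pt_inj]


/-- Cancellation of a common factor `g ∈ {2, 3, 4, 6, 8, 12, 24}`... generated instances, in the orientation produced by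
`hat_koD_mulP` (`j·b_z = ±(m·b)` with `24 = j·k`) and consumed by the divisor-class checks below. [folklore] -/
private theorem cancel_core (hp : p.Prime) (h5 : 5 ≤ p) {g : ℕ} (hg : g ∣ 24) {X Y : ZMod p}
    (hXY : (g : ZMod p) * X = (g : ZMod p) * Y) : X = Y := by
  haveI := Fact.mk hp
  have h2 : ¬ p ∣ 24 := by
    intro hd
    have h2' : p ∣ 2 ∨ p ∣ 3 := by
      rcases (Nat.Prime.dvd_mul hp).1 (show p ∣ 8 * 3 by simpa using hd) with h8 | h3
      · exact Or.inl (Nat.Prime.dvd_of_dvd_pow hp (show p ∣ 2 ^ 3 by simpa using h8))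
      · exact Or.inr h3
    rcases h2' with h | h
    · have := Nat.le_of_dvd (by norm_num) h; omega
    · have := Nat.le_of_dvd (by norm_num) h; omega
  have hg' : (g : ZMod p) ≠ 0 := by
    intro h0
    rw [ZMod.natCast_eq_zero_iff] at h0
    exact h2 (dvd_trans h0 hg)
  exact mul_left_cancel₀ hg' hXY

/-- `2b, 3b, 4b, 6b, 8b ≠ 0` for `b ≠ 0` in `ℤ/p`, `p ≥ 5` prime. [folklore] -/
private theorem mul_ne_zero_facts (hp : p.Prime) (h5 : 5 ≤ p) {b : ZMod p} (hb : b ≠ 0) :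
    (2 * b ≠ 0) ∧ (3 * b ≠ 0) ∧ (4 * b ≠ 0) ∧ (6 * b ≠ 0) ∧ (8 * b ≠ 0) := by
  refine ⟨fun e ↦ hb ?_, fun e ↦ hb ?_, fun e ↦ hb ?_, fun e ↦ hb ?_, fun e ↦ hb ?_⟩
  · exact cancel_core hp h5 (g := 2) (by norm_num) (by rw [mul_zero]; exact_mod_cast e)
  · exact cancel_core hp h5 (g := 3) (by norm_num) (by rw [mul_zero]; exact_mod_cast e)
  · exact cancel_core hp h5 (g := 4) (by norm_num) (by rw [mul_zero]; exact_mod_cast e)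
  · exact cancel_core hp h5 (g := 6) (by norm_num) (by rw [mul_zero]; exact_mod_cast e)
  · exact cancel_core hp h5 (g := 8) (by norm_num) (by rw [mul_zero]; exact_mod_cast e)

/-- `2·x = ±2·b ↔ ±1·b = 1·x` in `ℤ/p`. [folklore] -/
private theorem cc_2_2 (hp : p.Prime) (h5 : 5 ≤ p) (b x : ZMod p) :
    ((2 : ZMod p) * x = 2 * b ↔ b = x) ∧
    ((2 : ZMod p) * x = -(2 * b) ↔ -(b) = x) := by
  refine ⟨⟨fun e ↦ ?_, fun e ↦ ?_⟩, ⟨fun e ↦ ?_, fun e ↦ ?_⟩⟩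
  · refine cancel_core hp h5 (g := 2) (by norm_num) ?_
    push_cast; linear_combination -e
  · linear_combination -((2 : ZMod p) * e)
  · refine cancel_core hp h5 (g := 2) (by norm_num) ?_
    push_cast; linear_combination -e
  · linear_combination -((2 : ZMod p) * e)

/-- `2·x = ±4·b ↔ ±2·b = 1·x` in `ℤ/p`. [folklore] -/
private theorem cc_2_4 (hp : p.Prime) (h5 : 5 ≤ p) (b x : ZMod p) :
    ((2 : ZMod p) * x = 4 * b ↔ 2 * b = x) ∧
    ((2 : ZMod p) * x = -(4 * b) ↔ -(2 * b) = x) := by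
  refine ⟨⟨fun e ↦ ?_, fun e ↦ ?_⟩, ⟨fun e ↦ ?_, fun e ↦ ?_⟩⟩
  · refine cancel_core hp h5 (g := 2) (by norm_num) ?_
    push_cast; linear_combination -e
  · linear_combination -((2 : ZMod p) * e)
  · refine cancel_core hp h5 (g := 2) (by norm_num) ?_
    push_cast; linear_combination -e
  · linear_combination -((2 : ZMod p) * e)

/-- `2·x = ±6·b ↔ ±3·b = 1·x` in `ℤ/p`. [folklore] -/
private theorem cc_2_6 (hp : p.Prime) (h5 : 5 ≤ p) (b x : ZMod p) :
    ((2 : ZMod p) * x = 6 * b ↔ 3 * b = x) ∧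
    ((2 : ZMod p) * x = -(6 * b) ↔ -(3 * b) = x) := by
  refine ⟨⟨fun e ↦ ?_, fun e ↦ ?_⟩, ⟨fun e ↦ ?_, fun e ↦ ?_⟩⟩
  · refine cancel_core hp h5 (g := 2) (by norm_num) ?_
    push_cast; linear_combination -e
  · linear_combination -((2 : ZMod p) * e)
  · refine cancel_core hp h5 (g := 2) (by norm_num) ?_
    push_cast; linear_combination -e
  · linear_combination -((2 : ZMod p) * e)

/-- `2·x = ±8·b ↔ ±4·b = 1·x` in `ℤ/p`. [folklore] -/
private theorem cc_2_8 (hp : p.Prime) (h5 : 5 ≤ p) (b x : ZMod p) :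
    ((2 : ZMod p) * x = 8 * b ↔ 4 * b = x) ∧
    ((2 : ZMod p) * x = -(8 * b) ↔ -(4 * b) = x) := by
  refine ⟨⟨fun e ↦ ?_, fun e ↦ ?_⟩, ⟨fun e ↦ ?_, fun e ↦ ?_⟩⟩
  · refine cancel_core hp h5 (g := 2) (by norm_num) ?_
    push_cast; linear_combination -e
  · linear_combination -((2 : ZMod p) * e)
  · refine cancel_core hp h5 (g := 2) (by norm_num) ?_
    push_cast; linear_combination -e
  · linear_combination -((2 : ZMod p) * e)

/-- `3·x = ±3·b ↔ ±1·b = 1·x` in `ℤ/p`. [folklore] -/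
private theorem cc_3_3 (hp : p.Prime) (h5 : 5 ≤ p) (b x : ZMod p) :
    ((3 : ZMod p) * x = 3 * b ↔ b = x) ∧
    ((3 : ZMod p) * x = -(3 * b) ↔ -(b) = x) := by
  refine ⟨⟨fun e ↦ ?_, fun e ↦ ?_⟩, ⟨fun e ↦ ?_, fun e ↦ ?_⟩⟩
  · refine cancel_core hp h5 (g := 3) (by norm_num) ?_
    push_cast; linear_combination -e
  · linear_combination -((3 : ZMod p) * e)
  · refine cancel_core hp h5 (g := 3) (by norm_num) ?_
    push_cast; linear_combination -e
  · linear_combination -((3 : ZMod p) * e)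

/-- `3·x = ±6·b ↔ ±2·b = 1·x` in `ℤ/p`. [folklore] -/
private theorem cc_3_6 (hp : p.Prime) (h5 : 5 ≤ p) (b x : ZMod p) :
    ((3 : ZMod p) * x = 6 * b ↔ 2 * b = x) ∧
    ((3 : ZMod p) * x = -(6 * b) ↔ -(2 * b) = x) := by
  refine ⟨⟨fun e ↦ ?_, fun e ↦ ?_⟩, ⟨fun e ↦ ?_, fun e ↦ ?_⟩⟩
  · refine cancel_core hp h5 (g := 3) (by norm_num) ?_
    push_cast; linear_combination -e
  · linear_combination -((3 : ZMod p) * e)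
  · refine cancel_core hp h5 (g := 3) (by norm_num) ?_
    push_cast; linear_combination -e
  · linear_combination -((3 : ZMod p) * e)

/-- `4·x = ±2·b ↔ ±1·b = 2·x` in `ℤ/p`. [folklore] -/
private theorem cc_4_2 (hp : p.Prime) (h5 : 5 ≤ p) (b x : ZMod p) :
    ((4 : ZMod p) * x = 2 * b ↔ b = 2 * x) ∧
    ((4 : ZMod p) * x = -(2 * b) ↔ -(b) = 2 * x) := by
  refine ⟨⟨fun e ↦ ?_, fun e ↦ ?_⟩, ⟨fun e ↦ ?_, fun e ↦ ?_⟩⟩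
  · refine cancel_core hp h5 (g := 2) (by norm_num) ?_
    push_cast; linear_combination -e
  · linear_combination -((2 : ZMod p) * e)
  · refine cancel_core hp h5 (g := 2) (by norm_num) ?_
    push_cast; linear_combination -e
  · linear_combination -((2 : ZMod p) * e)

/-- `4·x = ±4·b ↔ ±1·b = 1·x` in `ℤ/p`. [folklore] -/
private theorem cc_4_4 (hp : p.Prime) (h5 : 5 ≤ p) (b x : ZMod p) :
    ((4 : ZMod p) * x = 4 * b ↔ b = x) ∧
    ((4 : ZMod p) * x = -(4 * b) ↔ -(b) = x) := by
  refine ⟨⟨fun e ↦ ?_, fun e ↦ ?_⟩, ⟨fun e ↦ ?_, fun e ↦ ?_⟩⟩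
  · refine cancel_core hp h5 (g := 4) (by norm_num) ?_
    push_cast; linear_combination -e
  · linear_combination -((4 : ZMod p) * e)
  · refine cancel_core hp h5 (g := 4) (by norm_num) ?_
    push_cast; linear_combination -e
  · linear_combination -((4 : ZMod p) * e)

/-- `4·x = ±6·b ↔ ±3·b = 2·x` in `ℤ/p`. [folklore] -/
private theorem cc_4_6 (hp : p.Prime) (h5 : 5 ≤ p) (b x : ZMod p) :
    ((4 : ZMod p) * x = 6 * b ↔ 3 * b = 2 * x) ∧
    ((4 : ZMod p) * x = -(6 * b) ↔ -(3 * b) = 2 * x) := by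
  refine ⟨⟨fun e ↦ ?_, fun e ↦ ?_⟩, ⟨fun e ↦ ?_, fun e ↦ ?_⟩⟩
  · refine cancel_core hp h5 (g := 2) (by norm_num) ?_
    push_cast; linear_combination -e
  · linear_combination -((2 : ZMod p) * e)
  · refine cancel_core hp h5 (g := 2) (by norm_num) ?_
    push_cast; linear_combination -e
  · linear_combination -((2 : ZMod p) * e)

/-- `4·x = ±8·b ↔ ±2·b = 1·x` in `ℤ/p`. [folklore] -/
private theorem cc_4_8 (hp : p.Prime) (h5 : 5 ≤ p) (b x : ZMod p) :
    ((4 : ZMod p) * x = 8 * b ↔ 2 * b = x) ∧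
    ((4 : ZMod p) * x = -(8 * b) ↔ -(2 * b) = x) := by
  refine ⟨⟨fun e ↦ ?_, fun e ↦ ?_⟩, ⟨fun e ↦ ?_, fun e ↦ ?_⟩⟩
  · refine cancel_core hp h5 (g := 4) (by norm_num) ?_
    push_cast; linear_combination -e
  · linear_combination -((4 : ZMod p) * e)
  · refine cancel_core hp h5 (g := 4) (by norm_num) ?_
    push_cast; linear_combination -e
  · linear_combination -((4 : ZMod p) * e)

/-- `6·x = ±2·b ↔ ±1·b = 3·x` in `ℤ/p`. [folklore] -/
private theorem cc_6_2 (hp : p.Prime) (h5 : 5 ≤ p) (b x : ZMod p) :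
    ((6 : ZMod p) * x = 2 * b ↔ b = 3 * x) ∧
    ((6 : ZMod p) * x = -(2 * b) ↔ -(b) = 3 * x) := by
  refine ⟨⟨fun e ↦ ?_, fun e ↦ ?_⟩, ⟨fun e ↦ ?_, fun e ↦ ?_⟩⟩
  · refine cancel_core hp h5 (g := 2) (by norm_num) ?_
    push_cast; linear_combination -e
  · linear_combination -((2 : ZMod p) * e)
  · refine cancel_core hp h5 (g := 2) (by norm_num) ?_
    push_cast; linear_combination -e
  · linear_combination -((2 : ZMod p) * e)

/-- `6·x = ±3·b ↔ ±1·b = 2·x` in `ℤ/p`. [folklore] -/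
private theorem cc_6_3 (hp : p.Prime) (h5 : 5 ≤ p) (b x : ZMod p) :
    ((6 : ZMod p) * x = 3 * b ↔ b = 2 * x) ∧
    ((6 : ZMod p) * x = -(3 * b) ↔ -(b) = 2 * x) := by
  refine ⟨⟨fun e ↦ ?_, fun e ↦ ?_⟩, ⟨fun e ↦ ?_, fun e ↦ ?_⟩⟩
  · refine cancel_core hp h5 (g := 3) (by norm_num) ?_
    push_cast; linear_combination -e
  · linear_combination -((3 : ZMod p) * e)
  · refine cancel_core hp h5 (g := 3) (by norm_num) ?_
    push_cast; linear_combination -e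
  · linear_combination -((3 : ZMod p) * e)

/-- `6·x = ±4·b ↔ ±2·b = 3·x` in `ℤ/p`. [folklore] -/
private theorem cc_6_4 (hp : p.Prime) (h5 : 5 ≤ p) (b x : ZMod p) :
    ((6 : ZMod p) * x = 4 * b ↔ 2 * b = 3 * x) ∧
    ((6 : ZMod p) * x = -(4 * b) ↔ -(2 * b) = 3 * x) := by
  refine ⟨⟨fun e ↦ ?_, fun e ↦ ?_⟩, ⟨fun e ↦ ?_, fun e ↦ ?_⟩⟩
  · refine cancel_core hp h5 (g := 2) (by norm_num) ?_
    push_cast; linear_combination -e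
  · linear_combination -((2 : ZMod p) * e)
  · refine cancel_core hp h5 (g := 2) (by norm_num) ?_
    push_cast; linear_combination -e
  · linear_combination -((2 : ZMod p) * e)

/-- `6·x = ±6·b ↔ ±1·b = 1·x` in `ℤ/p`. [folklore] -/
private theorem cc_6_6 (hp : p.Prime) (h5 : 5 ≤ p) (b x : ZMod p) :
    ((6 : ZMod p) * x = 6 * b ↔ b = x) ∧
    ((6 : ZMod p) * x = -(6 * b) ↔ -(b) = x) := by
  refine ⟨⟨fun e ↦ ?_, fun e ↦ ?_⟩, ⟨fun e ↦ ?_, fun e ↦ ?_⟩⟩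
  · refine cancel_core hp h5 (g := 6) (by norm_num) ?_
    push_cast; linear_combination -e
  · linear_combination -((6 : ZMod p) * e)
  · refine cancel_core hp h5 (g := 6) (by norm_num) ?_
    push_cast; linear_combination -e
  · linear_combination -((6 : ZMod p) * e)

/-- `6·x = ±8·b ↔ ±4·b = 3·x` in `ℤ/p`. [folklore] -/
private theorem cc_6_8 (hp : p.Prime) (h5 : 5 ≤ p) (b x : ZMod p) :
    ((6 : ZMod p) * x = 8 * b ↔ 4 * b = 3 * x) ∧
    ((6 : ZMod p) * x = -(8 * b) ↔ -(4 * b) = 3 * x) := by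
  refine ⟨⟨fun e ↦ ?_, fun e ↦ ?_⟩, ⟨fun e ↦ ?_, fun e ↦ ?_⟩⟩
  · refine cancel_core hp h5 (g := 2) (by norm_num) ?_
    push_cast; linear_combination -e
  · linear_combination -((2 : ZMod p) * e)
  · refine cancel_core hp h5 (g := 2) (by norm_num) ?_
    push_cast; linear_combination -e
  · linear_combination -((2 : ZMod p) * e)

/-- `8·x = ±2·b ↔ ±1·b = 4·x` in `ℤ/p`. [folklore] -/
private theorem cc_8_2 (hp : p.Prime) (h5 : 5 ≤ p) (b x : ZMod p) :
    ((8 : ZMod p) * x = 2 * b ↔ b = 4 * x) ∧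
    ((8 : ZMod p) * x = -(2 * b) ↔ -(b) = 4 * x) := by
  refine ⟨⟨fun e ↦ ?_, fun e ↦ ?_⟩, ⟨fun e ↦ ?_, fun e ↦ ?_⟩⟩
  · refine cancel_core hp h5 (g := 2) (by norm_num) ?_
    push_cast; linear_combination -e
  · linear_combination -((2 : ZMod p) * e)
  · refine cancel_core hp h5 (g := 2) (by norm_num) ?_
    push_cast; linear_combination -e
  · linear_combination -((2 : ZMod p) * e)

/-- `8·x = ±4·b ↔ ±1·b = 2·x` in `ℤ/p`. [folklore] -/
private theorem cc_8_4 (hp : p.Prime) (h5 : 5 ≤ p) (b x : ZMod p) :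
    ((8 : ZMod p) * x = 4 * b ↔ b = 2 * x) ∧
    ((8 : ZMod p) * x = -(4 * b) ↔ -(b) = 2 * x) := by
  refine ⟨⟨fun e ↦ ?_, fun e ↦ ?_⟩, ⟨fun e ↦ ?_, fun e ↦ ?_⟩⟩
  · refine cancel_core hp h5 (g := 4) (by norm_num) ?_
    push_cast; linear_combination -e
  · linear_combination -((4 : ZMod p) * e)
  · refine cancel_core hp h5 (g := 4) (by norm_num) ?_
    push_cast; linear_combination -e
  · linear_combination -((4 : ZMod p) * e)

/-- `8·x = ±6·b ↔ ±3·b = 4·x` in `ℤ/p`. [folklore] -/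
private theorem cc_8_6 (hp : p.Prime) (h5 : 5 ≤ p) (b x : ZMod p) :
    ((8 : ZMod p) * x = 6 * b ↔ 3 * b = 4 * x) ∧
    ((8 : ZMod p) * x = -(6 * b) ↔ -(3 * b) = 4 * x) := by
  refine ⟨⟨fun e ↦ ?_, fun e ↦ ?_⟩, ⟨fun e ↦ ?_, fun e ↦ ?_⟩⟩
  · refine cancel_core hp h5 (g := 2) (by norm_num) ?_
    push_cast; linear_combination -e
  · linear_combination -((2 : ZMod p) * e)
  · refine cancel_core hp h5 (g := 2) (by norm_num) ?_
    push_cast; linear_combination -e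
  · linear_combination -((2 : ZMod p) * e)

/-- `8·x = ±8·b ↔ ±1·b = 1·x` in `ℤ/p`. [folklore] -/
private theorem cc_8_8 (hp : p.Prime) (h5 : 5 ≤ p) (b x : ZMod p) :
    ((8 : ZMod p) * x = 8 * b ↔ b = x) ∧
    ((8 : ZMod p) * x = -(8 * b) ↔ -(b) = x) := by
  refine ⟨⟨fun e ↦ ?_, fun e ↦ ?_⟩, ⟨fun e ↦ ?_, fun e ↦ ?_⟩⟩
  · refine cancel_core hp h5 (g := 8) (by norm_num) ?_
    push_cast; linear_combination -e
  · linear_combination -((8 : ZMod p) * e)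
  · refine cancel_core hp h5 (g := 8) (by norm_num) ?_
    push_cast; linear_combination -e
  · linear_combination -((8 : ZMod p) * e)

/-- `12·x = ±2·b ↔ ±1·b = 6·x` in `ℤ/p`. [folklore] -/
private theorem cc_12_2 (hp : p.Prime) (h5 : 5 ≤ p) (b x : ZMod p) :
    ((12 : ZMod p) * x = 2 * b ↔ b = 6 * x) ∧
    ((12 : ZMod p) * x = -(2 * b) ↔ -(b) = 6 * x) := by
  refine ⟨⟨fun e ↦ ?_, fun e ↦ ?_⟩, ⟨fun e ↦ ?_, fun e ↦ ?_⟩⟩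
  · refine cancel_core hp h5 (g := 2) (by norm_num) ?_
    push_cast; linear_combination -e
  · linear_combination -((2 : ZMod p) * e)
  · refine cancel_core hp h5 (g := 2) (by norm_num) ?_
    push_cast; linear_combination -e
  · linear_combination -((2 : ZMod p) * e)

/-- `12·x = ±3·b ↔ ±1·b = 4·x` in `ℤ/p`. [folklore] -/
private theorem cc_12_3 (hp : p.Prime) (h5 : 5 ≤ p) (b x : ZMod p) :
    ((12 : ZMod p) * x = 3 * b ↔ b = 4 * x) ∧
    ((12 : ZMod p) * x = -(3 * b) ↔ -(b) = 4 * x) := by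
  refine ⟨⟨fun e ↦ ?_, fun e ↦ ?_⟩, ⟨fun e ↦ ?_, fun e ↦ ?_⟩⟩
  · refine cancel_core hp h5 (g := 3) (by norm_num) ?_
    push_cast; linear_combination -e
  · linear_combination -((3 : ZMod p) * e)
  · refine cancel_core hp h5 (g := 3) (by norm_num) ?_
    push_cast; linear_combination -e
  · linear_combination -((3 : ZMod p) * e)

/-- `12·x = ±4·b ↔ ±1·b = 3·x` in `ℤ/p`. [folklore] -/
private theorem cc_12_4 (hp : p.Prime) (h5 : 5 ≤ p) (b x : ZMod p) :
    ((12 : ZMod p) * x = 4 * b ↔ b = 3 * x) ∧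
    ((12 : ZMod p) * x = -(4 * b) ↔ -(b) = 3 * x) := by
  refine ⟨⟨fun e ↦ ?_, fun e ↦ ?_⟩, ⟨fun e ↦ ?_, fun e ↦ ?_⟩⟩
  · refine cancel_core hp h5 (g := 4) (by norm_num) ?_
    push_cast; linear_combination -e
  · linear_combination -((4 : ZMod p) * e)
  · refine cancel_core hp h5 (g := 4) (by norm_num) ?_
    push_cast; linear_combination -e
  · linear_combination -((4 : ZMod p) * e)

/-- `12·x = ±6·b ↔ ±1·b = 2·x` in `ℤ/p`. [folklore] -/
private theorem cc_12_6 (hp : p.Prime) (h5 : 5 ≤ p) (b x : ZMod p) :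
    ((12 : ZMod p) * x = 6 * b ↔ b = 2 * x) ∧
    ((12 : ZMod p) * x = -(6 * b) ↔ -(b) = 2 * x) := by
  refine ⟨⟨fun e ↦ ?_, fun e ↦ ?_⟩, ⟨fun e ↦ ?_, fun e ↦ ?_⟩⟩
  · refine cancel_core hp h5 (g := 6) (by norm_num) ?_
    push_cast; linear_combination -e
  · linear_combination -((6 : ZMod p) * e)
  · refine cancel_core hp h5 (g := 6) (by norm_num) ?_
    push_cast; linear_combination -e
  · linear_combination -((6 : ZMod p) * e)

/-- `12·x = ±8·b ↔ ±2·b = 3·x` in `ℤ/p`. [folklore] -/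
private theorem cc_12_8 (hp : p.Prime) (h5 : 5 ≤ p) (b x : ZMod p) :
    ((12 : ZMod p) * x = 8 * b ↔ 2 * b = 3 * x) ∧
    ((12 : ZMod p) * x = -(8 * b) ↔ -(2 * b) = 3 * x) := by
  refine ⟨⟨fun e ↦ ?_, fun e ↦ ?_⟩, ⟨fun e ↦ ?_, fun e ↦ ?_⟩⟩
  · refine cancel_core hp h5 (g := 4) (by norm_num) ?_
    push_cast; linear_combination -e
  · linear_combination -((4 : ZMod p) * e)
  · refine cancel_core hp h5 (g := 4) (by norm_num) ?_
    push_cast; linear_combination -e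
  · linear_combination -((4 : ZMod p) * e)

/-- `24·x = ±2·b ↔ ±1·b = 12·x` in `ℤ/p`. [folklore] -/
private theorem cc_24_2 (hp : p.Prime) (h5 : 5 ≤ p) (b x : ZMod p) :
    ((24 : ZMod p) * x = 2 * b ↔ b = 12 * x) ∧
    ((24 : ZMod p) * x = -(2 * b) ↔ -(b) = 12 * x) := by
  refine ⟨⟨fun e ↦ ?_, fun e ↦ ?_⟩, ⟨fun e ↦ ?_, fun e ↦ ?_⟩⟩
  · refine cancel_core hp h5 (g := 2) (by norm_num) ?_
    push_cast; linear_combination -e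
  · linear_combination -((2 : ZMod p) * e)
  · refine cancel_core hp h5 (g := 2) (by norm_num) ?_
    push_cast; linear_combination -e
  · linear_combination -((2 : ZMod p) * e)

/-- `24·x = ±3·b ↔ ±1·b = 8·x` in `ℤ/p`. [folklore] -/
private theorem cc_24_3 (hp : p.Prime) (h5 : 5 ≤ p) (b x : ZMod p) :
    ((24 : ZMod p) * x = 3 * b ↔ b = 8 * x) ∧
    ((24 : ZMod p) * x = -(3 * b) ↔ -(b) = 8 * x) := by
  refine ⟨⟨fun e ↦ ?_, fun e ↦ ?_⟩, ⟨fun e ↦ ?_, fun e ↦ ?_⟩⟩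
  · refine cancel_core hp h5 (g := 3) (by norm_num) ?_
    push_cast; linear_combination -e
  · linear_combination -((3 : ZMod p) * e)
  · refine cancel_core hp h5 (g := 3) (by norm_num) ?_
    push_cast; linear_combination -e
  · linear_combination -((3 : ZMod p) * e)

/-- `24·x = ±4·b ↔ ±1·b = 6·x` in `ℤ/p`. [folklore] -/
private theorem cc_24_4 (hp : p.Prime) (h5 : 5 ≤ p) (b x : ZMod p) :
    ((24 : ZMod p) * x = 4 * b ↔ b = 6 * x) ∧
    ((24 : ZMod p) * x = -(4 * b) ↔ -(b) = 6 * x) := by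
  refine ⟨⟨fun e ↦ ?_, fun e ↦ ?_⟩, ⟨fun e ↦ ?_, fun e ↦ ?_⟩⟩
  · refine cancel_core hp h5 (g := 4) (by norm_num) ?_
    push_cast; linear_combination -e
  · linear_combination -((4 : ZMod p) * e)
  · refine cancel_core hp h5 (g := 4) (by norm_num) ?_
    push_cast; linear_combination -e
  · linear_combination -((4 : ZMod p) * e)

/-- `24·x = ±6·b ↔ ±1·b = 4·x` in `ℤ/p`. [folklore] -/
private theorem cc_24_6 (hp : p.Prime) (h5 : 5 ≤ p) (b x : ZMod p) :
    ((24 : ZMod p) * x = 6 * b ↔ b = 4 * x) ∧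
    ((24 : ZMod p) * x = -(6 * b) ↔ -(b) = 4 * x) := by
  refine ⟨⟨fun e ↦ ?_, fun e ↦ ?_⟩, ⟨fun e ↦ ?_, fun e ↦ ?_⟩⟩
  · refine cancel_core hp h5 (g := 6) (by norm_num) ?_
    push_cast; linear_combination -e
  · linear_combination -((6 : ZMod p) * e)
  · refine cancel_core hp h5 (g := 6) (by norm_num) ?_
    push_cast; linear_combination -e
  · linear_combination -((6 : ZMod p) * e)

/-- `24·x = ±8·b ↔ ±1·b = 3·x` in `ℤ/p`. [folklore] -/
private theorem cc_24_8 (hp : p.Prime) (h5 : 5 ≤ p) (b x : ZMod p) :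
    ((24 : ZMod p) * x = 8 * b ↔ b = 3 * x) ∧
    ((24 : ZMod p) * x = -(8 * b) ↔ -(b) = 3 * x) := by
  refine ⟨⟨fun e ↦ ?_, fun e ↦ ?_⟩, ⟨fun e ↦ ?_, fun e ↦ ?_⟩⟩
  · refine cancel_core hp h5 (g := 8) (by norm_num) ?_
    push_cast; linear_combination -e
  · linear_combination -((8 : ZMod p) * e)
  · refine cancel_core hp h5 (g := 8) (by norm_num) ?_
    push_cast; linear_combination -e
  · linear_combination -((8 : ZMod p) * e)

/-- `2·x = ±1·b ↔ ±1·b = 2·x` (orientation). [folklore] -/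
private theorem co_2_1 (b x : ZMod p) :
    ((2 : ZMod p) * x = b ↔ b = 2 * x) ∧
    ((2 : ZMod p) * x = -b ↔ -b = 2 * x) := ⟨eq_comm, eq_comm⟩

/-- `2·x = ±3·b ↔ ±3·b = 2·x` (orientation). [folklore] -/
private theorem co_2_3 (b x : ZMod p) :
    ((2 : ZMod p) * x = 3 * b ↔ 3 * b = 2 * x) ∧
    ((2 : ZMod p) * x = -(3 * b) ↔ -(3 * b) = 2 * x) := ⟨eq_comm, eq_comm⟩

/-- `3·x = ±1·b ↔ ±1·b = 3·x` (orientation). [folklore] -/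
private theorem co_3_1 (b x : ZMod p) :
    ((3 : ZMod p) * x = b ↔ b = 3 * x) ∧
    ((3 : ZMod p) * x = -b ↔ -b = 3 * x) := ⟨eq_comm, eq_comm⟩

/-- `3·x = ±2·b ↔ ±2·b = 3·x` (orientation). [folklore] -/
private theorem co_3_2 (b x : ZMod p) :
    ((3 : ZMod p) * x = 2 * b ↔ 2 * b = 3 * x) ∧
    ((3 : ZMod p) * x = -(2 * b) ↔ -(2 * b) = 3 * x) := ⟨eq_comm, eq_comm⟩

/-- `3·x = ±4·b ↔ ±4·b = 3·x` (orientation). [folklore] -/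
private theorem co_3_4 (b x : ZMod p) :
    ((3 : ZMod p) * x = 4 * b ↔ 4 * b = 3 * x) ∧
    ((3 : ZMod p) * x = -(4 * b) ↔ -(4 * b) = 3 * x) := ⟨eq_comm, eq_comm⟩

/-- `3·x = ±8·b ↔ ±8·b = 3·x` (orientation). [folklore] -/
private theorem co_3_8 (b x : ZMod p) :
    ((3 : ZMod p) * x = 8 * b ↔ 8 * b = 3 * x) ∧
    ((3 : ZMod p) * x = -(8 * b) ↔ -(8 * b) = 3 * x) := ⟨eq_comm, eq_comm⟩

/-- `4·x = ±1·b ↔ ±1·b = 4·x` (orientation). [folklore] -/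
private theorem co_4_1 (b x : ZMod p) :
    ((4 : ZMod p) * x = b ↔ b = 4 * x) ∧
    ((4 : ZMod p) * x = -b ↔ -b = 4 * x) := ⟨eq_comm, eq_comm⟩

/-- `4·x = ±3·b ↔ ±3·b = 4·x` (orientation). [folklore] -/
private theorem co_4_3 (b x : ZMod p) :
    ((4 : ZMod p) * x = 3 * b ↔ 3 * b = 4 * x) ∧
    ((4 : ZMod p) * x = -(3 * b) ↔ -(3 * b) = 4 * x) := ⟨eq_comm, eq_comm⟩

/-- `6·x = ±1·b ↔ ±1·b = 6·x` (orientation). [folklore] -/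
private theorem co_6_1 (b x : ZMod p) :
    ((6 : ZMod p) * x = b ↔ b = 6 * x) ∧
    ((6 : ZMod p) * x = -b ↔ -b = 6 * x) := ⟨eq_comm, eq_comm⟩

/-- `8·x = ±1·b ↔ ±1·b = 8·x` (orientation). [folklore] -/
private theorem co_8_1 (b x : ZMod p) :
    ((8 : ZMod p) * x = b ↔ b = 8 * x) ∧
    ((8 : ZMod p) * x = -b ↔ -b = 8 * x) := ⟨eq_comm, eq_comm⟩

/-- `8·x = ±3·b ↔ ±3·b = 8·x` (orientation). [folklore] -/
private theorem co_8_3 (b x : ZMod p) :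
    ((8 : ZMod p) * x = 3 * b ↔ 3 * b = 8 * x) ∧
    ((8 : ZMod p) * x = -(3 * b) ↔ -(3 * b) = 8 * x) := ⟨eq_comm, eq_comm⟩

/-- `12·x = ±1·b ↔ ±1·b = 12·x` (orientation). [folklore] -/
private theorem co_12_1 (b x : ZMod p) :
    ((12 : ZMod p) * x = b ↔ b = 12 * x) ∧
    ((12 : ZMod p) * x = -b ↔ -b = 12 * x) := ⟨eq_comm, eq_comm⟩

/-- `24·x = ±1·b ↔ ±1·b = 24·x` (orientation). [folklore] -/
private theorem co_24_1 (b x : ZMod p) :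
    ((24 : ZMod p) * x = b ↔ b = 24 * x) ∧
    ((24 : ZMod p) * x = -b ↔ -b = 24 * x) := ⟨eq_comm, eq_comm⟩

/-! ### The five functionals of level `24p` -/

/-- `ĝ(w) = g(w) − g(−w)`: twice the odd part. [folklore] -/
private def hat (g : ZMod (24 * p) → ℚ) (w : ZMod (24 * p)) : ℚ := g w - g (-w)

/-- **The functional `U_ψ(b)`** (`ψ = χ₃χ₋₈`, even of conductor `24`): `Σ_{u ∈ (ℤ/24)ˣ} ψ(u) ĝ(u, b)`, `ψ = +1` on `{1, 5, 19,
23}`, `−1` on `{7, 11, 13, 17}`. [folklore] -/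
private def LPsi (h : Nat.Coprime 24 p) (g : ZMod (24 * p) → ℚ) (b : ZMod p) : ℚ :=
    hat g (pt h 1 b) + hat g (pt h 5 b) - hat g (pt h 7 b) - hat g (pt h 11 b) - hat g (pt h 13 b)
      - hat g (pt h 17 b) + hat g (pt h 19 b) + hat g (pt h 23 b)

/-- **The functional of the character `χ₈ = (2/·)`** (even, conductor `8`): `U_{χ₈}(b) + U_{χ₈}(3b) + 2T_{χ₈}(3b)`, `T_{χ₈}(c) =
ĝ(3,c) − ĝ(9,c) − ĝ(15,c) + ĝ(21,c)`. [folklore] -/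
private def LChi8 (h : Nat.Coprime 24 p) (g : ZMod (24 * p) → ℚ) (b : ZMod p) : ℚ :=
    hat g (pt h 1 b) - hat g (pt h 5 b) + hat g (pt h 7 b) - hat g (pt h 11 b) - hat g (pt h 13 b)
      + hat g (pt h 17 b) - hat g (pt h 19 b) + hat g (pt h 23 b) + hat g (pt h 1 (3 * b))
      - hat g (pt h 5 (3 * b)) + hat g (pt h 7 (3 * b)) - hat g (pt h 11 (3 * b)) - hat g (pt h 13 (3 * b))
      + hat g (pt h 17 (3 * b)) - hat g (pt h 19 (3 * b)) + hat g (pt h 23 (3 * b)) + hat g (pt h 3 (3 * b))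
      + hat g (pt h 3 (3 * b)) - hat g (pt h 9 (3 * b)) - hat g (pt h 9 (3 * b)) - hat g (pt h 15 (3 * b))
      - hat g (pt h 15 (3 * b)) + hat g (pt h 21 (3 * b)) + hat g (pt h 21 (3 * b))

/-- **`Γ_{−8}(b) = U_{χ₋₈}(b) − U_{χ₋₈}(3b) + 2T_{χ₋₈}(3b)`** (`χ₋₈ = (−2/·)`, odd, conductor `8`; `T_{χ₋₈}(c) = ĝ(3,c) + ĝ(9,c) −
ĝ(15,c) − ĝ(21,c)`). [folklore] -/
private def GamM8 (h : Nat.Coprime 24 p) (g : ZMod (24 * p) → ℚ) (b : ZMod p) : ℚ :=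
    hat g (pt h 1 b) - hat g (pt h 5 b) - hat g (pt h 7 b) + hat g (pt h 11 b) - hat g (pt h 13 b)
      + hat g (pt h 17 b) + hat g (pt h 19 b) - hat g (pt h 23 b) - hat g (pt h 1 (3 * b))
      + hat g (pt h 5 (3 * b)) + hat g (pt h 7 (3 * b)) - hat g (pt h 11 (3 * b)) + hat g (pt h 13 (3 * b))
      - hat g (pt h 17 (3 * b)) - hat g (pt h 19 (3 * b)) + hat g (pt h 23 (3 * b)) + hat g (pt h 3 (3 * b))
      + hat g (pt h 3 (3 * b)) + hat g (pt h 9 (3 * b)) + hat g (pt h 9 (3 * b)) - hat g (pt h 15 (3 * b))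
      - hat g (pt h 15 (3 * b)) - hat g (pt h 21 (3 * b)) - hat g (pt h 21 (3 * b))

/-- **`Γ₄(b) = U₄(b) + U₄(3b) + 2E₄(2b) + 2E₄(6b) + 2T₄(3b) + 4S₄(6b)`** (`χ₄` odd of conductor `4`; `E₄(c) = ĝ(2,c) + ĝ(10,c) −
ĝ(14,c) − ĝ(22,c)`, `T₄(c) = ĝ(3,c) − ĝ(9,c) + ĝ(15,c) − ĝ(21,c)`, `S₄(c) = ĝ(6,c) − ĝ(18,c)`). [folklore] -/
private def Gam4 (h : Nat.Coprime 24 p) (g : ZMod (24 * p) → ℚ) (b : ZMod p) : ℚ :=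
    hat g (pt h 1 b) + hat g (pt h 5 b) - hat g (pt h 7 b) - hat g (pt h 11 b) + hat g (pt h 13 b)
      + hat g (pt h 17 b) - hat g (pt h 19 b) - hat g (pt h 23 b) + hat g (pt h 1 (3 * b))
      + hat g (pt h 5 (3 * b)) - hat g (pt h 7 (3 * b)) - hat g (pt h 11 (3 * b)) + hat g (pt h 13 (3 * b))
      + hat g (pt h 17 (3 * b)) - hat g (pt h 19 (3 * b)) - hat g (pt h 23 (3 * b)) + hat g (pt h 2 (2 * b))
      + hat g (pt h 2 (2 * b)) + hat g (pt h 10 (2 * b)) + hat g (pt h 10 (2 * b)) - hat g (pt h 14 (2 * b))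
      - hat g (pt h 14 (2 * b)) - hat g (pt h 22 (2 * b)) - hat g (pt h 22 (2 * b)) + hat g (pt h 2 (6 * b))
      + hat g (pt h 2 (6 * b)) + hat g (pt h 10 (6 * b)) + hat g (pt h 10 (6 * b)) - hat g (pt h 14 (6 * b))
      - hat g (pt h 14 (6 * b)) - hat g (pt h 22 (6 * b)) - hat g (pt h 22 (6 * b)) + hat g (pt h 3 (3 * b))
      + hat g (pt h 3 (3 * b)) - hat g (pt h 9 (3 * b)) - hat g (pt h 9 (3 * b)) + hat g (pt h 15 (3 * b))
      + hat g (pt h 15 (3 * b)) - hat g (pt h 21 (3 * b)) - hat g (pt h 21 (3 * b)) + hat g (pt h 6 (6 * b))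
      + hat g (pt h 6 (6 * b)) + hat g (pt h 6 (6 * b)) + hat g (pt h 6 (6 * b)) - hat g (pt h 18 (6 * b))
      - hat g (pt h 18 (6 * b)) - hat g (pt h 18 (6 * b)) - hat g (pt h 18 (6 * b))

/-- **`Γ₃(b) = U₃(b) + U₃(2b) + 2E₃(2b) + 2E₃(4b) + 4Q₃(4b) + 4Q₃(8b) + 4O₃(8b)`** (`χ₃` odd of conductor `3`; `E₃(c) = ĝ(2,c) −
ĝ(10,c) + ĝ(14,c) − ĝ(22,c)`, `Q₃(c) = ĝ(4,c) − ĝ(20,c)`, `O₃(c) = ĝ(8,c) − ĝ(16,c)`). [folklore] -/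
private def Gam3 (h : Nat.Coprime 24 p) (g : ZMod (24 * p) → ℚ) (b : ZMod p) : ℚ :=
    hat g (pt h 1 b) - hat g (pt h 5 b) + hat g (pt h 7 b) - hat g (pt h 11 b) + hat g (pt h 13 b)
      - hat g (pt h 17 b) + hat g (pt h 19 b) - hat g (pt h 23 b) + hat g (pt h 1 (2 * b))
      - hat g (pt h 5 (2 * b)) + hat g (pt h 7 (2 * b)) - hat g (pt h 11 (2 * b)) + hat g (pt h 13 (2 * b))
      - hat g (pt h 17 (2 * b)) + hat g (pt h 19 (2 * b)) - hat g (pt h 23 (2 * b)) + hat g (pt h 2 (2 * b))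
      + hat g (pt h 2 (2 * b)) - hat g (pt h 10 (2 * b)) - hat g (pt h 10 (2 * b)) + hat g (pt h 14 (2 * b))
      + hat g (pt h 14 (2 * b)) - hat g (pt h 22 (2 * b)) - hat g (pt h 22 (2 * b)) + hat g (pt h 2 (4 * b))
      + hat g (pt h 2 (4 * b)) - hat g (pt h 10 (4 * b)) - hat g (pt h 10 (4 * b)) + hat g (pt h 14 (4 * b))
      + hat g (pt h 14 (4 * b)) - hat g (pt h 22 (4 * b)) - hat g (pt h 22 (4 * b)) + hat g (pt h 4 (4 * b))
      + hat g (pt h 4 (4 * b)) + hat g (pt h 4 (4 * b)) + hat g (pt h 4 (4 * b)) - hat g (pt h 20 (4 * b))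
      - hat g (pt h 20 (4 * b)) - hat g (pt h 20 (4 * b)) - hat g (pt h 20 (4 * b)) + hat g (pt h 4 (8 * b))
      + hat g (pt h 4 (8 * b)) + hat g (pt h 4 (8 * b)) + hat g (pt h 4 (8 * b)) - hat g (pt h 20 (8 * b))
      - hat g (pt h 20 (8 * b)) - hat g (pt h 20 (8 * b)) - hat g (pt h 20 (8 * b)) + hat g (pt h 8 (8 * b))
      + hat g (pt h 8 (8 * b)) + hat g (pt h 8 (8 * b)) + hat g (pt h 8 (8 * b)) - hat g (pt h 16 (8 * b))
      - hat g (pt h 16 (8 * b)) - hat g (pt h 16 (8 * b)) - hat g (pt h 16 (8 * b))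

/-- The difference `GamM8(b) − GamM8(b′)` (the relation is `= 0` for `b, b′ ≠ 0`). [folklore] -/
private def LM8 (h : Nat.Coprime 24 p) (g : ZMod (24 * p) → ℚ) (b b' : ZMod p) : ℚ := GamM8 h g b - GamM8 h g b'

/-- The difference `Gam4(b) − Gam4(b′)` (the relation is `= 0` for `b, b′ ≠ 0`). [folklore] -/
private def LIII (h : Nat.Coprime 24 p) (g : ZMod (24 * p) → ℚ) (b b' : ZMod p) : ℚ := Gam4 h g b - Gam4 h g b'

/-- The difference `Gam3(b) − Gam3(b′)` (the relation is `= 0` for `b, b′ ≠ 0`). [folklore] -/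
private def LIV (h : Nat.Coprime 24 p) (g : ZMod (24 * p) → ℚ) (b b' : ZMod p) : ℚ := Gam3 h g b - Gam3 h g b'

/-- `ĝ` is additive. [folklore] -/
private theorem hat_add (g g' : ZMod (24 * p) → ℚ) (w : ZMod (24 * p)) :
    hat (fun z ↦ g z + g' z) w = hat g w + hat g' w := by
  simp only [hat]; ring

/-- `ĝ` is homogeneous. [folklore] -/
private theorem hat_smul (a : ℚ) (g : ZMod (24 * p) → ℚ) (w : ZMod (24 * p)) :
    hat (fun z ↦ a * g z) w = a * hat g w := by
  simp only [hat]; ring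

/-- `ĝ` commutes with sums. [folklore] -/
private theorem hat_sum {ι : Type} (t : Finset ι) (g : ι → ZMod (24 * p) → ℚ) (w : ZMod (24 * p)) :
    hat (fun z ↦ ∑ i ∈ t, g i z) w = ∑ i ∈ t, hat (g i) w := by
  simp only [hat, Finset.sum_sub_distrib]

/-- `ĝ = 0` for negation-invariant `g`. [folklore] -/
private theorem hat_even {g : ZMod (24 * p) → ℚ} (hg : ∀ z, g (-z) = g z) (w : ZMod (24 * p)) : hat g w = 0 := by
  simp only [hat, hg, sub_self]

/-- `LPsi` is linear and kills negation-invariant functions. [folklore] -/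
private theorem LPsi_linear (h : Nat.Coprime 24 p) (b : ZMod p) :
    (∀ g g' : ZMod (24 * p) → ℚ, LPsi h (fun z ↦ g z + g' z) b = LPsi h g b + LPsi h g' b) ∧
    (∀ (a : ℚ) (g : ZMod (24 * p) → ℚ), LPsi h (fun z ↦ a * g z) b = a * LPsi h g b) ∧
    (∀ {ι : Type} (t : Finset ι) (g : ι → ZMod (24 * p) → ℚ), LPsi h (fun z ↦ ∑ i ∈ t, g i z) b = ∑ i ∈ t, LPsi h (g i) b) ∧
    (∀ g : ZMod (24 * p) → ℚ, (∀ z, g (-z) = g z) → LPsi h g b = 0) := by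
  refine ⟨fun g g' ↦ ?_, fun a g ↦ ?_, fun t g ↦ ?_, fun g hg ↦ ?_⟩
  · simp only [LPsi, hat_add]; ring
  · simp only [LPsi, hat_smul]; ring
  · simp only [LPsi, hat_sum, ← Finset.sum_add_distrib, ← Finset.sum_sub_distrib]
  · simp only [LPsi, hat_even hg]; ring

/-- `LChi8` is linear and kills negation-invariant functions. [folklore] -/
private theorem LChi8_linear (h : Nat.Coprime 24 p) (b : ZMod p) :
    (∀ g g' : ZMod (24 * p) → ℚ, LChi8 h (fun z ↦ g z + g' z) b = LChi8 h g b + LChi8 h g' b) ∧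
    (∀ (a : ℚ) (g : ZMod (24 * p) → ℚ), LChi8 h (fun z ↦ a * g z) b = a * LChi8 h g b) ∧
    (∀ {ι : Type} (t : Finset ι) (g : ι → ZMod (24 * p) → ℚ), LChi8 h (fun z ↦ ∑ i ∈ t, g i z) b = ∑ i ∈ t, LChi8 h (g i) b) ∧
    (∀ g : ZMod (24 * p) → ℚ, (∀ z, g (-z) = g z) → LChi8 h g b = 0) := by
  refine ⟨fun g g' ↦ ?_, fun a g ↦ ?_, fun t g ↦ ?_, fun g hg ↦ ?_⟩
  · simp only [LChi8, hat_add]; ring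
  · simp only [LChi8, hat_smul]; ring
  · simp only [LChi8, hat_sum, ← Finset.sum_add_distrib, ← Finset.sum_sub_distrib]
  · simp only [LChi8, hat_even hg]; ring

/-- `LM8` is linear and kills negation-invariant functions. [folklore] -/
private theorem LM8_linear (h : Nat.Coprime 24 p) (b b' : ZMod p) :
    (∀ g g' : ZMod (24 * p) → ℚ, LM8 h (fun z ↦ g z + g' z) b b' = LM8 h g b b' + LM8 h g' b b') ∧
    (∀ (a : ℚ) (g : ZMod (24 * p) → ℚ), LM8 h (fun z ↦ a * g z) b b' = a * LM8 h g b b') ∧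
    (∀ {ι : Type} (t : Finset ι) (g : ι → ZMod (24 * p) → ℚ),
      LM8 h (fun z ↦ ∑ i ∈ t, g i z) b b' = ∑ i ∈ t, LM8 h (g i) b b') ∧
    (∀ g : ZMod (24 * p) → ℚ, (∀ z, g (-z) = g z) → LM8 h g b b' = 0) := by
  refine ⟨fun g g' ↦ ?_, fun a g ↦ ?_, fun t g ↦ ?_, fun g hg ↦ ?_⟩
  · simp only [LM8, GamM8, hat_add]; ring
  · simp only [LM8, GamM8, hat_smul]; ring
  · simp only [LM8, GamM8, hat_sum, ← Finset.sum_add_distrib, ← Finset.sum_sub_distrib]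
  · simp only [LM8, GamM8, hat_even hg]; ring

/-- `LIII` is linear and kills negation-invariant functions. [folklore] -/
private theorem LIII_linear (h : Nat.Coprime 24 p) (b b' : ZMod p) :
    (∀ g g' : ZMod (24 * p) → ℚ, LIII h (fun z ↦ g z + g' z) b b' = LIII h g b b' + LIII h g' b b') ∧
    (∀ (a : ℚ) (g : ZMod (24 * p) → ℚ), LIII h (fun z ↦ a * g z) b b' = a * LIII h g b b') ∧
    (∀ {ι : Type} (t : Finset ι) (g : ι → ZMod (24 * p) → ℚ),
      LIII h (fun z ↦ ∑ i ∈ t, g i z) b b' = ∑ i ∈ t, LIII h (g i) b b') ∧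
    (∀ g : ZMod (24 * p) → ℚ, (∀ z, g (-z) = g z) → LIII h g b b' = 0) := by
  refine ⟨fun g g' ↦ ?_, fun a g ↦ ?_, fun t g ↦ ?_, fun g hg ↦ ?_⟩
  · simp only [LIII, Gam4, hat_add]; ring
  · simp only [LIII, Gam4, hat_smul]; ring
  · simp only [LIII, Gam4, hat_sum, ← Finset.sum_add_distrib, ← Finset.sum_sub_distrib]
  · simp only [LIII, Gam4, hat_even hg]; ring

/-- `LIV` is linear and kills negation-invariant functions. [folklore] -/
private theorem LIV_linear (h : Nat.Coprime 24 p) (b b' : ZMod p) :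
    (∀ g g' : ZMod (24 * p) → ℚ, LIV h (fun z ↦ g z + g' z) b b' = LIV h g b b' + LIV h g' b b') ∧
    (∀ (a : ℚ) (g : ZMod (24 * p) → ℚ), LIV h (fun z ↦ a * g z) b b' = a * LIV h g b b') ∧
    (∀ {ι : Type} (t : Finset ι) (g : ι → ZMod (24 * p) → ℚ),
      LIV h (fun z ↦ ∑ i ∈ t, g i z) b b' = ∑ i ∈ t, LIV h (g i) b b') ∧
    (∀ g : ZMod (24 * p) → ℚ, (∀ z, g (-z) = g z) → LIV h g b b' = 0) := by
  refine ⟨fun g g' ↦ ?_, fun a g ↦ ?_, fun t g ↦ ?_, fun g hg ↦ ?_⟩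
  · simp only [LIV, Gam3, hat_add]; ring
  · simp only [LIV, Gam3, hat_smul]; ring
  · simp only [LIV, Gam3, hat_sum, ← Finset.sum_add_distrib, ← Finset.sum_sub_distrib]
  · simp only [LIV, Gam3, hat_even hg]; ring

/-! ### The functionals kill every distribution vector -/

/-- A point with non-zero second coordinate is not of the form `pt e 0`. [folklore] -/
private theorem pt_ne_pt_zero (h : Nat.Coprime 24 p) {c : ZMod p} (hc : c ≠ 0) (e e' : ZMod 24) :
    pt h e' 0 ≠ pt h e c := fun eq ↦ hc ((pt_inj h).1 eq).2.symm

/-- `ĝ` of a distribution vector at a coordinate point, unfolded. [folklore] -/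
private theorem hat_koD (h : Nat.Coprime 24 p) (M : ℕ) (z : ZMod (24 * p)) (e : ZMod 24) (c : ZMod p) :
    hat (koD (24 * p) M z) (pt h e c) =
      ((if (pt h e c).val % M = z.val % M then (1 : ℚ) else 0) -
        (if (pt h (-e) (-c)).val % M = z.val % M then (1 : ℚ) else 0)) -
      ((if ((24 * p / M : ℕ) : ZMod (24 * p)) * z = pt h e c then (1 : ℚ) else 0) -
        (if ((24 * p / M : ℕ) : ZMod (24 * p)) * z = pt h (-e) (-c) then (1 : ℚ) else 0)) := by
  simp only [hat, koD, neg_pt]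
  ring

/-- The distribution vector of level `24p` is zero. [folklore] -/
private theorem koD_top [NeZero (24 * p)] (z w : ZMod (24 * p)) : koD (24 * p) (24 * p) z w = 0 := by
  have h0 : (24 * p) ≠ 0 := NeZero.ne _
  simp only [koD, Nat.mod_eq_of_lt (ZMod.val_lt _), Nat.div_self (Nat.pos_of_ne_zero h0), Nat.cast_one, one_mul]
  by_cases hw : w = z
  · rw [if_pos (by rw [hw]), if_pos hw.symm, sub_self]
  · rw [if_neg (fun e ↦ hw (ZMod.val_injective _ e)), if_neg (fun e ↦ hw e.symm), sub_self]

/-- Level `k ∣ 24`: `ĝ(e, c) = [e ≡ e_z (k)] − [−e ≡ e_z (k)]` off the fibre `0`. [folklore] -/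
private theorem hat_koD_dvd (h : Nat.Coprime 24 p) [NeZero (24 * p)] {k : ℕ} (hk : k ∣ 24) (hk0 : 0 < k)
    (ez e : ZMod 24) {bz c : ZMod p} (hc : c ≠ 0) : hat (koD (24 * p) k (pt h ez bz)) (pt h e c) =
      (if e.val % k = ez.val % k then (1 : ℚ) else 0) - (if (-e).val % k = ez.val % k then (1 : ℚ) else 0) := by
  rw [hat_koD]
  obtain ⟨j, hj⟩ := hk
  have hjk : (24 * p / k : ℕ) = j * p := by
    rw [hj, mul_assoc]; exact Nat.mul_div_cancel_left _ hk0
  have hP : ((j * p : ℕ) : ZMod p) = 0 := by rw [Nat.cast_mul, ZMod.natCast_self, mul_zero]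
  have n1 : ((j * p : ℕ) : ZMod (24 * p)) * pt h ez bz ≠ pt h e c := by
    rw [natCast_mul_pt, hP, zero_mul]; exact pt_ne_pt_zero h hc _ _
  have n2 : ((j * p : ℕ) : ZMod (24 * p)) * pt h ez bz ≠ pt h (-e) (-c) := by
    rw [natCast_mul_pt, hP, zero_mul]; exact pt_ne_pt_zero h (neg_ne_zero.2 hc) _ _
  rw [hjk, if_neg n1, if_neg n2]
  simp only [mod_dvd_twentyFour_iff h ⟨j, hj⟩, crt_pt, sub_zero]

/-- Level `p`: `ĝ(e, c) = [c = b_z] − [−c = b_z] − [0 = e, 24b_z = c] + [0 = −e, 24b_z = −c]`. [folklore] -/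
private theorem hat_koD_P (h : Nat.Coprime 24 p) [NeZero (24 * p)] (hp : p.Prime) (ez e : ZMod 24) (bz c : ZMod p) :
    hat (koD (24 * p) p (pt h ez bz)) (pt h e c) =
      ((if c = bz then (1 : ℚ) else 0) - (if -c = bz then (1 : ℚ) else 0)) -
      ((if 0 = e ∧ 24 * bz = c then (1 : ℚ) else 0) - (if 0 = -e ∧ 24 * bz = -c then (1 : ℚ) else 0)) := by
  rw [hat_koD]
  have h12 : (24 * p / p : ℕ) = 24 := Nat.mul_div_cancel 24 hp.pos
  have h120 : (24 : ZMod 24) * ez = 0 := by rw [show (24 : ZMod 24) = 0 by decide, zero_mul]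
  rw [h12]
  simp only [natCast_mul_eq_pt_iff]
  simp only [mod_p_iff h, crt_pt, Nat.cast_ofNat, h120]

/-- Level `k·p`, `k ∣ 24`, `24 = j·k`: `ĝ(e, c) = [e ≡ e_z (k), c = b_z] − [−e ≡ e_z (k), −c = b_z] − [j e_z = e, j b_z = c]
 + [j e_z = −e, j b_z = −c]`. [folklore] -/
private theorem hat_koD_mulP (h : Nat.Coprime 24 p) [NeZero (24 * p)] (hp : p.Prime) {k j : ℕ} (hjk : 24 = j * k)
    (ez e : ZMod 24) (bz c : ZMod p) :
    hat (koD (24 * p) (k * p) (pt h ez bz)) (pt h e c) =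
      ((if e.val % k = ez.val % k ∧ c = bz then (1 : ℚ) else 0) -
        (if (-e).val % k = ez.val % k ∧ -c = bz then (1 : ℚ) else 0)) -
      ((if (j : ZMod 24) * ez = e ∧ (j : ZMod p) * bz = c then (1 : ℚ) else 0) -
        (if (j : ZMod 24) * ez = -e ∧ (j : ZMod p) * bz = -c then (1 : ℚ) else 0)) := by
  rw [hat_koD]
  have hk0 : 0 < k := Nat.pos_of_ne_zero fun h0 ↦ by rw [h0, mul_zero] at hjk; exact absurd hjk (by norm_num)
  have hj : (24 * p / (k * p) : ℕ) = j := by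
    rw [hjk, show j * k * p = j * (k * p) by ring]; exact Nat.mul_div_cancel j (Nat.mul_pos hk0 hp.pos)
  rw [hj]
  simp only [natCast_mul_eq_pt_iff]
  simp only [mod_dvd_twentyFour_mul_iff h ⟨j, by rw [hjk, mul_comm]⟩, crt_pt]

/-- `LPsi` kills `D_{1,z}`. [folklore] -/
private theorem LPsi_koD_1 (h : Nat.Coprime 24 p) [NeZero (24 * p)]
    (ez : ZMod 24) (bz : ZMod p) {b : ZMod p} (hb : b ≠ 0) :
    LPsi h (koD (24 * p) 1 (pt h ez bz)) b = 0 := by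
  simp only [LPsi,
    hat_koD_dvd h (by norm_num : 1 ∣ 24) (by norm_num) _ _ hb]
  fin_cases ez <;> simp +decide

/-- `LPsi` kills `D_{2,z}`. [folklore] -/
private theorem LPsi_koD_2 (h : Nat.Coprime 24 p) [NeZero (24 * p)]
    (ez : ZMod 24) (bz : ZMod p) {b : ZMod p} (hb : b ≠ 0) :
    LPsi h (koD (24 * p) 2 (pt h ez bz)) b = 0 := by
  simp only [LPsi,
    hat_koD_dvd h (by norm_num : 2 ∣ 24) (by norm_num) _ _ hb]
  fin_cases ez <;> simp +decide

/-- `LPsi` kills `D_{3,z}`. [folklore] -/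
private theorem LPsi_koD_3 (h : Nat.Coprime 24 p) [NeZero (24 * p)]
    (ez : ZMod 24) (bz : ZMod p) {b : ZMod p} (hb : b ≠ 0) :
    LPsi h (koD (24 * p) 3 (pt h ez bz)) b = 0 := by
  simp only [LPsi,
    hat_koD_dvd h (by norm_num : 3 ∣ 24) (by norm_num) _ _ hb]
  fin_cases ez <;> simp +decide

/-- `LPsi` kills `D_{4,z}`. [folklore] -/
private theorem LPsi_koD_4 (h : Nat.Coprime 24 p) [NeZero (24 * p)]
    (ez : ZMod 24) (bz : ZMod p) {b : ZMod p} (hb : b ≠ 0) :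
    LPsi h (koD (24 * p) 4 (pt h ez bz)) b = 0 := by
  simp only [LPsi,
    hat_koD_dvd h (by norm_num : 4 ∣ 24) (by norm_num) _ _ hb]
  fin_cases ez <;> simp +decide

/-- `LPsi` kills `D_{6,z}`. [folklore] -/
private theorem LPsi_koD_6 (h : Nat.Coprime 24 p) [NeZero (24 * p)]
    (ez : ZMod 24) (bz : ZMod p) {b : ZMod p} (hb : b ≠ 0) :
    LPsi h (koD (24 * p) 6 (pt h ez bz)) b = 0 := by
  simp only [LPsi,
    hat_koD_dvd h (by norm_num : 6 ∣ 24) (by norm_num) _ _ hb]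
  fin_cases ez <;> simp +decide

/-- `LPsi` kills `D_{8,z}`. [folklore] -/
private theorem LPsi_koD_8 (h : Nat.Coprime 24 p) [NeZero (24 * p)]
    (ez : ZMod 24) (bz : ZMod p) {b : ZMod p} (hb : b ≠ 0) :
    LPsi h (koD (24 * p) 8 (pt h ez bz)) b = 0 := by
  simp only [LPsi,
    hat_koD_dvd h (by norm_num : 8 ∣ 24) (by norm_num) _ _ hb]
  fin_cases ez <;> simp +decide

/-- `LPsi` kills `D_{12,z}`. [folklore] -/
private theorem LPsi_koD_12 (h : Nat.Coprime 24 p) [NeZero (24 * p)]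
    (ez : ZMod 24) (bz : ZMod p) {b : ZMod p} (hb : b ≠ 0) :
    LPsi h (koD (24 * p) 12 (pt h ez bz)) b = 0 := by
  simp only [LPsi,
    hat_koD_dvd h (by norm_num : 12 ∣ 24) (by norm_num) _ _ hb]
  fin_cases ez <;> simp +decide

/-- `LPsi` kills `D_{24p,z} = 0`. [folklore] -/
private theorem LPsi_koD_top (h : Nat.Coprime 24 p) [NeZero (24 * p)] (z : ZMod (24 * p)) (b : ZMod p) :
    LPsi h (koD (24 * p) (24 * p) z) b = 0 := by
  simp only [LPsi, hat, koD_top, sub_self]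
  norm_num

/-- `LPsi` kills `D_{p,z}`. [folklore] -/
private theorem LPsi_koD_P (h : Nat.Coprime 24 p) [NeZero (24 * p)] (hp : p.Prime)
    (ez : ZMod 24) (bz : ZMod p) (b : ZMod p) :
    LPsi h (koD (24 * p) p (pt h ez bz)) b = 0 := by
  simp only [LPsi, hat_koD_P h hp]
  fin_cases ez <;> simp +decide

/-- `LPsi` kills `D_{2p,z}`. [folklore] -/
private theorem LPsi_koD_2P (h : Nat.Coprime 24 p) [NeZero (24 * p)] (hp : p.Prime)
    (ez : ZMod 24) (bz : ZMod p) (b : ZMod p) :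
    LPsi h (koD (24 * p) (2 * p) (pt h ez bz)) b = 0 := by
  simp only [LPsi, hat_koD_mulP h hp (k := 2) (j := 12) (by norm_num), Nat.cast_ofNat]
  fin_cases ez <;> simp +decide [
    (co_12_1 (p := p) b bz).1, (co_12_1 (p := p) b bz).2]

/-- `LPsi` kills `D_{3p,z}`. [folklore] -/
private theorem LPsi_koD_3P (h : Nat.Coprime 24 p) [NeZero (24 * p)] (hp : p.Prime)
    (ez : ZMod 24) (bz : ZMod p) (b : ZMod p) :
    LPsi h (koD (24 * p) (3 * p) (pt h ez bz)) b = 0 := by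
  simp only [LPsi, hat_koD_mulP h hp (k := 3) (j := 8) (by norm_num), Nat.cast_ofNat]
  fin_cases ez <;> simp +decide [
    (co_8_1 (p := p) b bz).1, (co_8_1 (p := p) b bz).2] <;> ring

/-- `LPsi` kills `D_{4p,z}`. [folklore] -/
private theorem LPsi_koD_4P (h : Nat.Coprime 24 p) [NeZero (24 * p)] (hp : p.Prime)
    (ez : ZMod 24) (bz : ZMod p) (b : ZMod p) :
    LPsi h (koD (24 * p) (4 * p) (pt h ez bz)) b = 0 := by
  simp only [LPsi, hat_koD_mulP h hp (k := 4) (j := 6) (by norm_num), Nat.cast_ofNat]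
  fin_cases ez <;> simp +decide [
    (co_6_1 (p := p) b bz).1, (co_6_1 (p := p) b bz).2] <;> ring

/-- `LPsi` kills `D_{6p,z}`. [folklore] -/
private theorem LPsi_koD_6P (h : Nat.Coprime 24 p) [NeZero (24 * p)] (hp : p.Prime)
    (ez : ZMod 24) (bz : ZMod p) (b : ZMod p) :
    LPsi h (koD (24 * p) (6 * p) (pt h ez bz)) b = 0 := by
  simp only [LPsi, hat_koD_mulP h hp (k := 6) (j := 4) (by norm_num), Nat.cast_ofNat]
  fin_cases ez <;> simp +decide [
    (co_4_1 (p := p) b bz).1, (co_4_1 (p := p) b bz).2] <;> ring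

/-- `LPsi` kills `D_{8p,z}`. [folklore] -/
private theorem LPsi_koD_8P (h : Nat.Coprime 24 p) [NeZero (24 * p)] (hp : p.Prime)
    (ez : ZMod 24) (bz : ZMod p) (b : ZMod p) :
    LPsi h (koD (24 * p) (8 * p) (pt h ez bz)) b = 0 := by
  simp only [LPsi, hat_koD_mulP h hp (k := 8) (j := 3) (by norm_num), Nat.cast_ofNat]
  fin_cases ez <;> simp +decide [
    (co_3_1 (p := p) b bz).1, (co_3_1 (p := p) b bz).2] <;> ring

/-- `LPsi` kills `D_{12p,z}`. [folklore] -/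
private theorem LPsi_koD_12P (h : Nat.Coprime 24 p) [NeZero (24 * p)] (hp : p.Prime)
    (ez : ZMod 24) (bz : ZMod p) (b : ZMod p) :
    LPsi h (koD (24 * p) (12 * p) (pt h ez bz)) b = 0 := by
  simp only [LPsi, hat_koD_mulP h hp (k := 12) (j := 2) (by norm_num), Nat.cast_ofNat]
  fin_cases ez <;> simp +decide [
    (co_2_1 (p := p) b bz).1, (co_2_1 (p := p) b bz).2] <;> ring

/-- `LPsi` kills `D_{24,z}`. [folklore] -/
private theorem LPsi_koD_24 (h : Nat.Coprime 24 p) [NeZero (24 * p)]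
    (ez : ZMod 24) (bz : ZMod p) {b : ZMod p} (hb : b ≠ 0) :
    LPsi h (koD (24 * p) 24 (pt h ez bz)) b = 0 := by
  simp only [LPsi,
    hat_koD_dvd h (by norm_num : 24 ∣ 24) (by norm_num) _ _ hb]
  fin_cases ez <;> simp +decide

/-- **`LPsi` kills every distribution vector.** [folklore] -/
private theorem LPsi_koD (h : Nat.Coprime 24 p) [NeZero (24 * p)] (hp : p.Prime) (h5 : 5 ≤ p) {M : ℕ}
    (hM : M ∈ (24 * p).divisors) (z : ZMod (24 * p)) {b : ZMod p} (hb : b ≠ 0) :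
    LPsi h (koD (24 * p) M z) b = 0 := by
  obtain ⟨ez, bz, rfl⟩ : ∃ ez bz, z = pt h ez bz := ⟨_, _, (pt_crt h z).symm⟩
  rcases eq_of_dvd_twentyFour_mul_prime hp h5 (Nat.dvd_of_mem_divisors hM) with
    rfl | rfl | rfl | rfl | rfl | rfl | rfl | rfl | rfl | rfl | rfl | rfl | rfl | rfl | rfl | hM24
  · exact LPsi_koD_1 h ez bz hb
  · exact LPsi_koD_2 h ez bz hb
  · exact LPsi_koD_3 h ez bz hb
  · exact LPsi_koD_4 h ez bz hb
  · exact LPsi_koD_6 h ez bz hb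
  · exact LPsi_koD_8 h ez bz hb
  · exact LPsi_koD_12 h ez bz hb
  · -- `k = 24`: the congruence is mod `24`, the point lies in the fibre `0`
    exact LPsi_koD_24 h ez bz hb
  · exact LPsi_koD_P h hp ez bz b
  · exact LPsi_koD_2P h hp ez bz b
  · exact LPsi_koD_3P h hp ez bz b
  · exact LPsi_koD_4P h hp ez bz b
  · exact LPsi_koD_6P h hp ez bz b
  · exact LPsi_koD_8P h hp ez bz b
  · exact LPsi_koD_12P h hp ez bz b
  · rw [hM24]; exact LPsi_koD_top h _ b

/-- `LChi8` kills `D_{1,z}`. [folklore] -/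
private theorem LChi8_koD_1 (h : Nat.Coprime 24 p) [NeZero (24 * p)] (hp : p.Prime) (h5 : 5 ≤ p)
    (ez : ZMod 24) (bz : ZMod p) {b : ZMod p} (hb : b ≠ 0) :
    LChi8 h (koD (24 * p) 1 (pt h ez bz)) b = 0 := by
  obtain ⟨-, h3b, -, -, -⟩ := mul_ne_zero_facts hp h5 hb
  simp only [LChi8,
    hat_koD_dvd h (by norm_num : 1 ∣ 24) (by norm_num) _ _ hb,
    hat_koD_dvd h (by norm_num : 1 ∣ 24) (by norm_num) _ _ h3b]
  fin_cases ez <;> simp +decide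

/-- `LChi8` kills `D_{2,z}`. [folklore] -/
private theorem LChi8_koD_2 (h : Nat.Coprime 24 p) [NeZero (24 * p)] (hp : p.Prime) (h5 : 5 ≤ p)
    (ez : ZMod 24) (bz : ZMod p) {b : ZMod p} (hb : b ≠ 0) :
    LChi8 h (koD (24 * p) 2 (pt h ez bz)) b = 0 := by
  obtain ⟨-, h3b, -, -, -⟩ := mul_ne_zero_facts hp h5 hb
  simp only [LChi8,
    hat_koD_dvd h (by norm_num : 2 ∣ 24) (by norm_num) _ _ hb,
    hat_koD_dvd h (by norm_num : 2 ∣ 24) (by norm_num) _ _ h3b]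
  fin_cases ez <;> simp +decide

/-- `LChi8` kills `D_{3,z}`. [folklore] -/
private theorem LChi8_koD_3 (h : Nat.Coprime 24 p) [NeZero (24 * p)] (hp : p.Prime) (h5 : 5 ≤ p)
    (ez : ZMod 24) (bz : ZMod p) {b : ZMod p} (hb : b ≠ 0) :
    LChi8 h (koD (24 * p) 3 (pt h ez bz)) b = 0 := by
  obtain ⟨-, h3b, -, -, -⟩ := mul_ne_zero_facts hp h5 hb
  simp only [LChi8,
    hat_koD_dvd h (by norm_num : 3 ∣ 24) (by norm_num) _ _ hb,
    hat_koD_dvd h (by norm_num : 3 ∣ 24) (by norm_num) _ _ h3b]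
  fin_cases ez <;> simp +decide

/-- `LChi8` kills `D_{4,z}`. [folklore] -/
private theorem LChi8_koD_4 (h : Nat.Coprime 24 p) [NeZero (24 * p)] (hp : p.Prime) (h5 : 5 ≤ p)
    (ez : ZMod 24) (bz : ZMod p) {b : ZMod p} (hb : b ≠ 0) :
    LChi8 h (koD (24 * p) 4 (pt h ez bz)) b = 0 := by
  obtain ⟨-, h3b, -, -, -⟩ := mul_ne_zero_facts hp h5 hb
  simp only [LChi8,
    hat_koD_dvd h (by norm_num : 4 ∣ 24) (by norm_num) _ _ hb,
    hat_koD_dvd h (by norm_num : 4 ∣ 24) (by norm_num) _ _ h3b]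
  fin_cases ez <;> simp +decide

/-- `LChi8` kills `D_{6,z}`. [folklore] -/
private theorem LChi8_koD_6 (h : Nat.Coprime 24 p) [NeZero (24 * p)] (hp : p.Prime) (h5 : 5 ≤ p)
    (ez : ZMod 24) (bz : ZMod p) {b : ZMod p} (hb : b ≠ 0) :
    LChi8 h (koD (24 * p) 6 (pt h ez bz)) b = 0 := by
  obtain ⟨-, h3b, -, -, -⟩ := mul_ne_zero_facts hp h5 hb
  simp only [LChi8,
    hat_koD_dvd h (by norm_num : 6 ∣ 24) (by norm_num) _ _ hb,
    hat_koD_dvd h (by norm_num : 6 ∣ 24) (by norm_num) _ _ h3b]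
  fin_cases ez <;> simp +decide

/-- `LChi8` kills `D_{8,z}`. [folklore] -/
private theorem LChi8_koD_8 (h : Nat.Coprime 24 p) [NeZero (24 * p)] (hp : p.Prime) (h5 : 5 ≤ p)
    (ez : ZMod 24) (bz : ZMod p) {b : ZMod p} (hb : b ≠ 0) :
    LChi8 h (koD (24 * p) 8 (pt h ez bz)) b = 0 := by
  obtain ⟨-, h3b, -, -, -⟩ := mul_ne_zero_facts hp h5 hb
  simp only [LChi8,
    hat_koD_dvd h (by norm_num : 8 ∣ 24) (by norm_num) _ _ hb,
    hat_koD_dvd h (by norm_num : 8 ∣ 24) (by norm_num) _ _ h3b]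
  fin_cases ez <;> simp +decide

/-- `LChi8` kills `D_{12,z}`. [folklore] -/
private theorem LChi8_koD_12 (h : Nat.Coprime 24 p) [NeZero (24 * p)] (hp : p.Prime) (h5 : 5 ≤ p)
    (ez : ZMod 24) (bz : ZMod p) {b : ZMod p} (hb : b ≠ 0) :
    LChi8 h (koD (24 * p) 12 (pt h ez bz)) b = 0 := by
  obtain ⟨-, h3b, -, -, -⟩ := mul_ne_zero_facts hp h5 hb
  simp only [LChi8,
    hat_koD_dvd h (by norm_num : 12 ∣ 24) (by norm_num) _ _ hb,
    hat_koD_dvd h (by norm_num : 12 ∣ 24) (by norm_num) _ _ h3b]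
  fin_cases ez <;> simp +decide

/-- `LChi8` kills `D_{24p,z} = 0`. [folklore] -/
private theorem LChi8_koD_top (h : Nat.Coprime 24 p) [NeZero (24 * p)] (z : ZMod (24 * p)) (b : ZMod p) :
    LChi8 h (koD (24 * p) (24 * p) z) b = 0 := by
  simp only [LChi8, hat, koD_top, sub_self]
  norm_num

/-- `LChi8` kills `D_{p,z}`. [folklore] -/
private theorem LChi8_koD_P (h : Nat.Coprime 24 p) [NeZero (24 * p)] (hp : p.Prime)
    (ez : ZMod 24) (bz : ZMod p) (b : ZMod p) :
    LChi8 h (koD (24 * p) p (pt h ez bz)) b = 0 := by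
  simp only [LChi8, hat_koD_P h hp]
  fin_cases ez <;> simp +decide

/-- `LChi8` kills `D_{2p,z}`. [folklore] -/
private theorem LChi8_koD_2P (h : Nat.Coprime 24 p) [NeZero (24 * p)] (hp : p.Prime) (h5 : 5 ≤ p)
    (ez : ZMod 24) (bz : ZMod p) (b : ZMod p) :
    LChi8 h (koD (24 * p) (2 * p) (pt h ez bz)) b = 0 := by
  simp only [LChi8, hat_koD_mulP h hp (k := 2) (j := 12) (by norm_num), Nat.cast_ofNat]
  fin_cases ez <;> simp +decide [
    (co_12_1 (p := p) b bz).1, (co_12_1 (p := p) b bz).2, (cc_12_3 (p := p) hp h5 b bz).1, (cc_12_3 (p := p) hp h5 b bz).2]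

/-- `LChi8` kills `D_{3p,z}`. [folklore] -/
private theorem LChi8_koD_3P (h : Nat.Coprime 24 p) [NeZero (24 * p)] (hp : p.Prime)
    (ez : ZMod 24) (bz : ZMod p) (b : ZMod p) :
    LChi8 h (koD (24 * p) (3 * p) (pt h ez bz)) b = 0 := by
  simp only [LChi8, hat_koD_mulP h hp (k := 3) (j := 8) (by norm_num), Nat.cast_ofNat]
  fin_cases ez <;> simp +decide [
    (co_8_1 (p := p) b bz).1, (co_8_1 (p := p) b bz).2, (co_8_3 (p := p) b bz).1, (co_8_3 (p := p) b bz).2] <;> ring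

/-- `LChi8` kills `D_{4p,z}`. [folklore] -/
private theorem LChi8_koD_4P (h : Nat.Coprime 24 p) [NeZero (24 * p)] (hp : p.Prime) (h5 : 5 ≤ p)
    (ez : ZMod 24) (bz : ZMod p) (b : ZMod p) :
    LChi8 h (koD (24 * p) (4 * p) (pt h ez bz)) b = 0 := by
  simp only [LChi8, hat_koD_mulP h hp (k := 4) (j := 6) (by norm_num), Nat.cast_ofNat]
  fin_cases ez <;> simp +decide [
    (co_6_1 (p := p) b bz).1, (co_6_1 (p := p) b bz).2, (cc_6_3 (p := p) hp h5 b bz).1, (cc_6_3 (p := p) hp h5 b bz).2] <;> ring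

/-- `LChi8` kills `D_{6p,z}`. [folklore] -/
private theorem LChi8_koD_6P (h : Nat.Coprime 24 p) [NeZero (24 * p)] (hp : p.Prime)
    (ez : ZMod 24) (bz : ZMod p) (b : ZMod p) :
    LChi8 h (koD (24 * p) (6 * p) (pt h ez bz)) b = 0 := by
  simp only [LChi8, hat_koD_mulP h hp (k := 6) (j := 4) (by norm_num), Nat.cast_ofNat]
  fin_cases ez <;> simp +decide [
    (co_4_1 (p := p) b bz).1, (co_4_1 (p := p) b bz).2, (co_4_3 (p := p) b bz).1, (co_4_3 (p := p) b bz).2] <;> ring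

/-- `LChi8` kills `D_{8p,z}`. [folklore] -/
private theorem LChi8_koD_8P (h : Nat.Coprime 24 p) [NeZero (24 * p)] (hp : p.Prime) (h5 : 5 ≤ p)
    (ez : ZMod 24) (bz : ZMod p) (b : ZMod p) :
    LChi8 h (koD (24 * p) (8 * p) (pt h ez bz)) b = 0 := by
  simp only [LChi8, hat_koD_mulP h hp (k := 8) (j := 3) (by norm_num), Nat.cast_ofNat]
  fin_cases ez <;> simp +decide [
    (co_3_1 (p := p) b bz).1, (co_3_1 (p := p) b bz).2, (cc_3_3 (p := p) hp h5 b bz).1, (cc_3_3 (p := p) hp h5 b bz).2] <;> ring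

/-- `LChi8` kills `D_{12p,z}`. [folklore] -/
private theorem LChi8_koD_12P (h : Nat.Coprime 24 p) [NeZero (24 * p)] (hp : p.Prime)
    (ez : ZMod 24) (bz : ZMod p) (b : ZMod p) :
    LChi8 h (koD (24 * p) (12 * p) (pt h ez bz)) b = 0 := by
  simp only [LChi8, hat_koD_mulP h hp (k := 12) (j := 2) (by norm_num), Nat.cast_ofNat]
  fin_cases ez <;> simp +decide [
    (co_2_1 (p := p) b bz).1, (co_2_1 (p := p) b bz).2, (co_2_3 (p := p) b bz).1, (co_2_3 (p := p) b bz).2] <;> ring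

/-- `LChi8` kills `D_{24,z}`. [folklore] -/
private theorem LChi8_koD_24 (h : Nat.Coprime 24 p) [NeZero (24 * p)] (hp : p.Prime) (h5 : 5 ≤ p)
    (ez : ZMod 24) (bz : ZMod p) {b : ZMod p} (hb : b ≠ 0) :
    LChi8 h (koD (24 * p) 24 (pt h ez bz)) b = 0 := by
  obtain ⟨-, h3b, -, -, -⟩ := mul_ne_zero_facts hp h5 hb
  simp only [LChi8,
    hat_koD_dvd h (by norm_num : 24 ∣ 24) (by norm_num) _ _ hb,
    hat_koD_dvd h (by norm_num : 24 ∣ 24) (by norm_num) _ _ h3b]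
  fin_cases ez <;> simp +decide

/-- **`LChi8` kills every distribution vector.** [folklore] -/
private theorem LChi8_koD (h : Nat.Coprime 24 p) [NeZero (24 * p)] (hp : p.Prime) (h5 : 5 ≤ p) {M : ℕ}
    (hM : M ∈ (24 * p).divisors) (z : ZMod (24 * p)) {b : ZMod p} (hb : b ≠ 0) :
    LChi8 h (koD (24 * p) M z) b = 0 := by
  obtain ⟨ez, bz, rfl⟩ : ∃ ez bz, z = pt h ez bz := ⟨_, _, (pt_crt h z).symm⟩
  rcases eq_of_dvd_twentyFour_mul_prime hp h5 (Nat.dvd_of_mem_divisors hM) with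
    rfl | rfl | rfl | rfl | rfl | rfl | rfl | rfl | rfl | rfl | rfl | rfl | rfl | rfl | rfl | hM24
  · exact LChi8_koD_1 h hp h5 ez bz hb
  · exact LChi8_koD_2 h hp h5 ez bz hb
  · exact LChi8_koD_3 h hp h5 ez bz hb
  · exact LChi8_koD_4 h hp h5 ez bz hb
  · exact LChi8_koD_6 h hp h5 ez bz hb
  · exact LChi8_koD_8 h hp h5 ez bz hb
  · exact LChi8_koD_12 h hp h5 ez bz hb
  · -- `k = 24`: the congruence is mod `24`, the point lies in the fibre `0`
    exact LChi8_koD_24 h hp h5 ez bz hb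
  · exact LChi8_koD_P h hp ez bz b
  · exact LChi8_koD_2P h hp h5 ez bz b
  · exact LChi8_koD_3P h hp ez bz b
  · exact LChi8_koD_4P h hp h5 ez bz b
  · exact LChi8_koD_6P h hp ez bz b
  · exact LChi8_koD_8P h hp h5 ez bz b
  · exact LChi8_koD_12P h hp ez bz b
  · rw [hM24]; exact LChi8_koD_top h _ b

/-- `LM8` kills `D_{1,z}`. [folklore] -/
private theorem LM8_koD_1 (h : Nat.Coprime 24 p) [NeZero (24 * p)] (hp : p.Prime) (h5 : 5 ≤ p)
    (ez : ZMod 24) (bz : ZMod p) {b b' : ZMod p} (hb : b ≠ 0) (hb' : b' ≠ 0) :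
    LM8 h (koD (24 * p) 1 (pt h ez bz)) b b' = 0 := by
  obtain ⟨-, h3b, -, -, -⟩ := mul_ne_zero_facts hp h5 hb
  obtain ⟨-, h3b', -, -, -⟩ := mul_ne_zero_facts hp h5 hb'
  simp only [LM8, GamM8,
    hat_koD_dvd h (by norm_num : 1 ∣ 24) (by norm_num) _ _ hb,
    hat_koD_dvd h (by norm_num : 1 ∣ 24) (by norm_num) _ _ h3b,
    hat_koD_dvd h (by norm_num : 1 ∣ 24) (by norm_num) _ _ hb',
    hat_koD_dvd h (by norm_num : 1 ∣ 24) (by norm_num) _ _ h3b']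
  fin_cases ez <;> simp +decide

/-- `LM8` kills `D_{2,z}`. [folklore] -/
private theorem LM8_koD_2 (h : Nat.Coprime 24 p) [NeZero (24 * p)] (hp : p.Prime) (h5 : 5 ≤ p)
    (ez : ZMod 24) (bz : ZMod p) {b b' : ZMod p} (hb : b ≠ 0) (hb' : b' ≠ 0) :
    LM8 h (koD (24 * p) 2 (pt h ez bz)) b b' = 0 := by
  obtain ⟨-, h3b, -, -, -⟩ := mul_ne_zero_facts hp h5 hb
  obtain ⟨-, h3b', -, -, -⟩ := mul_ne_zero_facts hp h5 hb'
  simp only [LM8, GamM8,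
    hat_koD_dvd h (by norm_num : 2 ∣ 24) (by norm_num) _ _ hb,
    hat_koD_dvd h (by norm_num : 2 ∣ 24) (by norm_num) _ _ h3b,
    hat_koD_dvd h (by norm_num : 2 ∣ 24) (by norm_num) _ _ hb',
    hat_koD_dvd h (by norm_num : 2 ∣ 24) (by norm_num) _ _ h3b']
  fin_cases ez <;> simp +decide

/-- `LM8` kills `D_{3,z}`. [folklore] -/
private theorem LM8_koD_3 (h : Nat.Coprime 24 p) [NeZero (24 * p)] (hp : p.Prime) (h5 : 5 ≤ p)
    (ez : ZMod 24) (bz : ZMod p) {b b' : ZMod p} (hb : b ≠ 0) (hb' : b' ≠ 0) :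
    LM8 h (koD (24 * p) 3 (pt h ez bz)) b b' = 0 := by
  obtain ⟨-, h3b, -, -, -⟩ := mul_ne_zero_facts hp h5 hb
  obtain ⟨-, h3b', -, -, -⟩ := mul_ne_zero_facts hp h5 hb'
  simp only [LM8, GamM8,
    hat_koD_dvd h (by norm_num : 3 ∣ 24) (by norm_num) _ _ hb,
    hat_koD_dvd h (by norm_num : 3 ∣ 24) (by norm_num) _ _ h3b,
    hat_koD_dvd h (by norm_num : 3 ∣ 24) (by norm_num) _ _ hb',
    hat_koD_dvd h (by norm_num : 3 ∣ 24) (by norm_num) _ _ h3b']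
  fin_cases ez <;> simp +decide

/-- `LM8` kills `D_{4,z}`. [folklore] -/
private theorem LM8_koD_4 (h : Nat.Coprime 24 p) [NeZero (24 * p)] (hp : p.Prime) (h5 : 5 ≤ p)
    (ez : ZMod 24) (bz : ZMod p) {b b' : ZMod p} (hb : b ≠ 0) (hb' : b' ≠ 0) :
    LM8 h (koD (24 * p) 4 (pt h ez bz)) b b' = 0 := by
  obtain ⟨-, h3b, -, -, -⟩ := mul_ne_zero_facts hp h5 hb
  obtain ⟨-, h3b', -, -, -⟩ := mul_ne_zero_facts hp h5 hb'
  simp only [LM8, GamM8,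
    hat_koD_dvd h (by norm_num : 4 ∣ 24) (by norm_num) _ _ hb,
    hat_koD_dvd h (by norm_num : 4 ∣ 24) (by norm_num) _ _ h3b,
    hat_koD_dvd h (by norm_num : 4 ∣ 24) (by norm_num) _ _ hb',
    hat_koD_dvd h (by norm_num : 4 ∣ 24) (by norm_num) _ _ h3b']
  fin_cases ez <;> simp +decide

/-- `LM8` kills `D_{6,z}`. [folklore] -/
private theorem LM8_koD_6 (h : Nat.Coprime 24 p) [NeZero (24 * p)] (hp : p.Prime) (h5 : 5 ≤ p)
    (ez : ZMod 24) (bz : ZMod p) {b b' : ZMod p} (hb : b ≠ 0) (hb' : b' ≠ 0) :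
    LM8 h (koD (24 * p) 6 (pt h ez bz)) b b' = 0 := by
  obtain ⟨-, h3b, -, -, -⟩ := mul_ne_zero_facts hp h5 hb
  obtain ⟨-, h3b', -, -, -⟩ := mul_ne_zero_facts hp h5 hb'
  simp only [LM8, GamM8,
    hat_koD_dvd h (by norm_num : 6 ∣ 24) (by norm_num) _ _ hb,
    hat_koD_dvd h (by norm_num : 6 ∣ 24) (by norm_num) _ _ h3b,
    hat_koD_dvd h (by norm_num : 6 ∣ 24) (by norm_num) _ _ hb',
    hat_koD_dvd h (by norm_num : 6 ∣ 24) (by norm_num) _ _ h3b']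
  fin_cases ez <;> simp +decide

/-- `LM8` kills `D_{8,z}`. [folklore] -/
private theorem LM8_koD_8 (h : Nat.Coprime 24 p) [NeZero (24 * p)] (hp : p.Prime) (h5 : 5 ≤ p)
    (ez : ZMod 24) (bz : ZMod p) {b b' : ZMod p} (hb : b ≠ 0) (hb' : b' ≠ 0) :
    LM8 h (koD (24 * p) 8 (pt h ez bz)) b b' = 0 := by
  obtain ⟨-, h3b, -, -, -⟩ := mul_ne_zero_facts hp h5 hb
  obtain ⟨-, h3b', -, -, -⟩ := mul_ne_zero_facts hp h5 hb'
  simp only [LM8, GamM8,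
    hat_koD_dvd h (by norm_num : 8 ∣ 24) (by norm_num) _ _ hb,
    hat_koD_dvd h (by norm_num : 8 ∣ 24) (by norm_num) _ _ h3b,
    hat_koD_dvd h (by norm_num : 8 ∣ 24) (by norm_num) _ _ hb',
    hat_koD_dvd h (by norm_num : 8 ∣ 24) (by norm_num) _ _ h3b']
  fin_cases ez <;> simp +decide

/-- `LM8` kills `D_{12,z}`. [folklore] -/
private theorem LM8_koD_12 (h : Nat.Coprime 24 p) [NeZero (24 * p)] (hp : p.Prime) (h5 : 5 ≤ p)
    (ez : ZMod 24) (bz : ZMod p) {b b' : ZMod p} (hb : b ≠ 0) (hb' : b' ≠ 0) :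
    LM8 h (koD (24 * p) 12 (pt h ez bz)) b b' = 0 := by
  obtain ⟨-, h3b, -, -, -⟩ := mul_ne_zero_facts hp h5 hb
  obtain ⟨-, h3b', -, -, -⟩ := mul_ne_zero_facts hp h5 hb'
  simp only [LM8, GamM8,
    hat_koD_dvd h (by norm_num : 12 ∣ 24) (by norm_num) _ _ hb,
    hat_koD_dvd h (by norm_num : 12 ∣ 24) (by norm_num) _ _ h3b,
    hat_koD_dvd h (by norm_num : 12 ∣ 24) (by norm_num) _ _ hb',
    hat_koD_dvd h (by norm_num : 12 ∣ 24) (by norm_num) _ _ h3b']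
  fin_cases ez <;> simp +decide

/-- `LM8` kills `D_{24p,z} = 0`. [folklore] -/
private theorem LM8_koD_top (h : Nat.Coprime 24 p) [NeZero (24 * p)] (z : ZMod (24 * p)) (b b' : ZMod p) :
    LM8 h (koD (24 * p) (24 * p) z) b b' = 0 := by
  simp only [LM8, GamM8, hat, koD_top, sub_self]

/-- `LM8` kills `D_{p,z}`. [folklore] -/
private theorem LM8_koD_P (h : Nat.Coprime 24 p) [NeZero (24 * p)] (hp : p.Prime)
    (ez : ZMod 24) (bz : ZMod p) (b b' : ZMod p) :
    LM8 h (koD (24 * p) p (pt h ez bz)) b b' = 0 := by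
  simp only [LM8, GamM8, hat_koD_P h hp]
  fin_cases ez <;> simp +decide

/-- `LM8` kills `D_{2p,z}`. [folklore] -/
private theorem LM8_koD_2P (h : Nat.Coprime 24 p) [NeZero (24 * p)] (hp : p.Prime) (h5 : 5 ≤ p)
    (ez : ZMod 24) (bz : ZMod p) (b b' : ZMod p) :
    LM8 h (koD (24 * p) (2 * p) (pt h ez bz)) b b' = 0 := by
  simp only [LM8, GamM8, hat_koD_mulP h hp (k := 2) (j := 12) (by norm_num), Nat.cast_ofNat]
  fin_cases ez <;> simp +decide [
    (co_12_1 (p := p) b bz).1, (co_12_1 (p := p) b bz).2, (cc_12_3 (p := p) hp h5 b bz).1, (cc_12_3 (p := p) hp h5 b bz).2,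
    (co_12_1 (p := p) b' bz).1, (co_12_1 (p := p) b' bz).2, (cc_12_3 (p := p) hp h5 b' bz).1, (cc_12_3 (p := p) hp h5 b' bz).2]

/-- `LM8` kills `D_{3p,z}`. [folklore] -/
private theorem LM8_koD_3P (h : Nat.Coprime 24 p) [NeZero (24 * p)] (hp : p.Prime)
    (ez : ZMod 24) (bz : ZMod p) (b b' : ZMod p) :
    LM8 h (koD (24 * p) (3 * p) (pt h ez bz)) b b' = 0 := by
  simp only [LM8, GamM8, hat_koD_mulP h hp (k := 3) (j := 8) (by norm_num), Nat.cast_ofNat]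
  fin_cases ez <;> simp +decide [
    (co_8_1 (p := p) b bz).1, (co_8_1 (p := p) b bz).2, (co_8_3 (p := p) b bz).1, (co_8_3 (p := p) b bz).2,
    (co_8_1 (p := p) b' bz).1, (co_8_1 (p := p) b' bz).2, (co_8_3 (p := p) b' bz).1, (co_8_3 (p := p) b' bz).2] <;> ring

/-- `LM8` kills `D_{4p,z}`. [folklore] -/
private theorem LM8_koD_4P (h : Nat.Coprime 24 p) [NeZero (24 * p)] (hp : p.Prime) (h5 : 5 ≤ p)
    (ez : ZMod 24) (bz : ZMod p) (b b' : ZMod p) :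
    LM8 h (koD (24 * p) (4 * p) (pt h ez bz)) b b' = 0 := by
  simp only [LM8, GamM8, hat_koD_mulP h hp (k := 4) (j := 6) (by norm_num), Nat.cast_ofNat]
  fin_cases ez <;> simp +decide [
    (co_6_1 (p := p) b bz).1, (co_6_1 (p := p) b bz).2, (cc_6_3 (p := p) hp h5 b bz).1, (cc_6_3 (p := p) hp h5 b bz).2,
    (co_6_1 (p := p) b' bz).1, (co_6_1 (p := p) b' bz).2, (cc_6_3 (p := p) hp h5 b' bz).1, (cc_6_3 (p := p) hp h5 b' bz).2] <;> ring

/-- `LM8` kills `D_{6p,z}`. [folklore] -/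
private theorem LM8_koD_6P (h : Nat.Coprime 24 p) [NeZero (24 * p)] (hp : p.Prime)
    (ez : ZMod 24) (bz : ZMod p) (b b' : ZMod p) :
    LM8 h (koD (24 * p) (6 * p) (pt h ez bz)) b b' = 0 := by
  simp only [LM8, GamM8, hat_koD_mulP h hp (k := 6) (j := 4) (by norm_num), Nat.cast_ofNat]
  fin_cases ez <;> simp +decide [
    (co_4_1 (p := p) b bz).1, (co_4_1 (p := p) b bz).2, (co_4_3 (p := p) b bz).1, (co_4_3 (p := p) b bz).2,
    (co_4_1 (p := p) b' bz).1, (co_4_1 (p := p) b' bz).2, (co_4_3 (p := p) b' bz).1, (co_4_3 (p := p) b' bz).2] <;> ring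

/-- `LM8` kills `D_{8p,z}`. [folklore] -/
private theorem LM8_koD_8P (h : Nat.Coprime 24 p) [NeZero (24 * p)] (hp : p.Prime) (h5 : 5 ≤ p)
    (ez : ZMod 24) (bz : ZMod p) (b b' : ZMod p) :
    LM8 h (koD (24 * p) (8 * p) (pt h ez bz)) b b' = 0 := by
  simp only [LM8, GamM8, hat_koD_mulP h hp (k := 8) (j := 3) (by norm_num), Nat.cast_ofNat]
  fin_cases ez <;> simp +decide [
    (co_3_1 (p := p) b bz).1, (co_3_1 (p := p) b bz).2, (cc_3_3 (p := p) hp h5 b bz).1, (cc_3_3 (p := p) hp h5 b bz).2,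
    (co_3_1 (p := p) b' bz).1, (co_3_1 (p := p) b' bz).2, (cc_3_3 (p := p) hp h5 b' bz).1, (cc_3_3 (p := p) hp h5 b' bz).2] <;> ring

/-- `LM8` kills `D_{12p,z}`. [folklore] -/
private theorem LM8_koD_12P (h : Nat.Coprime 24 p) [NeZero (24 * p)] (hp : p.Prime)
    (ez : ZMod 24) (bz : ZMod p) (b b' : ZMod p) :
    LM8 h (koD (24 * p) (12 * p) (pt h ez bz)) b b' = 0 := by
  simp only [LM8, GamM8, hat_koD_mulP h hp (k := 12) (j := 2) (by norm_num), Nat.cast_ofNat]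
  fin_cases ez <;> simp +decide [
    (co_2_1 (p := p) b bz).1, (co_2_1 (p := p) b bz).2, (co_2_3 (p := p) b bz).1, (co_2_3 (p := p) b bz).2,
    (co_2_1 (p := p) b' bz).1, (co_2_1 (p := p) b' bz).2, (co_2_3 (p := p) b' bz).1, (co_2_3 (p := p) b' bz).2] <;> ring

/-- `LM8` kills `D_{24,z}`. [folklore] -/
private theorem LM8_koD_24 (h : Nat.Coprime 24 p) [NeZero (24 * p)] (hp : p.Prime) (h5 : 5 ≤ p)
    (ez : ZMod 24) (bz : ZMod p) {b b' : ZMod p} (hb : b ≠ 0) (hb' : b' ≠ 0) :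
    LM8 h (koD (24 * p) 24 (pt h ez bz)) b b' = 0 := by
  obtain ⟨-, h3b, -, -, -⟩ := mul_ne_zero_facts hp h5 hb
  obtain ⟨-, h3b', -, -, -⟩ := mul_ne_zero_facts hp h5 hb'
  simp only [LM8, GamM8,
    hat_koD_dvd h (by norm_num : 24 ∣ 24) (by norm_num) _ _ hb,
    hat_koD_dvd h (by norm_num : 24 ∣ 24) (by norm_num) _ _ h3b,
    hat_koD_dvd h (by norm_num : 24 ∣ 24) (by norm_num) _ _ hb',
    hat_koD_dvd h (by norm_num : 24 ∣ 24) (by norm_num) _ _ h3b']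
  fin_cases ez <;> simp +decide

/-- **`LM8` kills every distribution vector.** [folklore] -/
private theorem LM8_koD (h : Nat.Coprime 24 p) [NeZero (24 * p)] (hp : p.Prime) (h5 : 5 ≤ p) {M : ℕ}
    (hM : M ∈ (24 * p).divisors) (z : ZMod (24 * p)) {b b' : ZMod p} (hb : b ≠ 0) (hb' : b' ≠ 0) :
    LM8 h (koD (24 * p) M z) b b' = 0 := by
  obtain ⟨ez, bz, rfl⟩ : ∃ ez bz, z = pt h ez bz := ⟨_, _, (pt_crt h z).symm⟩
  rcases eq_of_dvd_twentyFour_mul_prime hp h5 (Nat.dvd_of_mem_divisors hM) with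
    rfl | rfl | rfl | rfl | rfl | rfl | rfl | rfl | rfl | rfl | rfl | rfl | rfl | rfl | rfl | hM24
  · exact LM8_koD_1 h hp h5 ez bz hb hb'
  · exact LM8_koD_2 h hp h5 ez bz hb hb'
  · exact LM8_koD_3 h hp h5 ez bz hb hb'
  · exact LM8_koD_4 h hp h5 ez bz hb hb'
  · exact LM8_koD_6 h hp h5 ez bz hb hb'
  · exact LM8_koD_8 h hp h5 ez bz hb hb'
  · exact LM8_koD_12 h hp h5 ez bz hb hb'
  · -- `k = 24`: the congruence is mod `24`, the point lies in the fibre `0`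
    exact LM8_koD_24 h hp h5 ez bz hb hb'
  · exact LM8_koD_P h hp ez bz b b'
  · exact LM8_koD_2P h hp h5 ez bz b b'
  · exact LM8_koD_3P h hp ez bz b b'
  · exact LM8_koD_4P h hp h5 ez bz b b'
  · exact LM8_koD_6P h hp ez bz b b'
  · exact LM8_koD_8P h hp h5 ez bz b b'
  · exact LM8_koD_12P h hp ez bz b b'
  · rw [hM24]; exact LM8_koD_top h _ b b'

/-- `LIII` kills `D_{1,z}`. [folklore] -/
private theorem LIII_koD_1 (h : Nat.Coprime 24 p) [NeZero (24 * p)] (hp : p.Prime) (h5 : 5 ≤ p)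
    (ez : ZMod 24) (bz : ZMod p) {b b' : ZMod p} (hb : b ≠ 0) (hb' : b' ≠ 0) :
    LIII h (koD (24 * p) 1 (pt h ez bz)) b b' = 0 := by
  obtain ⟨h2b, h3b, -, h6b, -⟩ := mul_ne_zero_facts hp h5 hb
  obtain ⟨h2b', h3b', -, h6b', -⟩ := mul_ne_zero_facts hp h5 hb'
  simp only [LIII, Gam4,
    hat_koD_dvd h (by norm_num : 1 ∣ 24) (by norm_num) _ _ hb,
    hat_koD_dvd h (by norm_num : 1 ∣ 24) (by norm_num) _ _ h2b,
    hat_koD_dvd h (by norm_num : 1 ∣ 24) (by norm_num) _ _ h3b,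
    hat_koD_dvd h (by norm_num : 1 ∣ 24) (by norm_num) _ _ h6b,
    hat_koD_dvd h (by norm_num : 1 ∣ 24) (by norm_num) _ _ hb',
    hat_koD_dvd h (by norm_num : 1 ∣ 24) (by norm_num) _ _ h2b',
    hat_koD_dvd h (by norm_num : 1 ∣ 24) (by norm_num) _ _ h3b',
    hat_koD_dvd h (by norm_num : 1 ∣ 24) (by norm_num) _ _ h6b']
  fin_cases ez <;> simp +decide

/-- `LIII` kills `D_{2,z}`. [folklore] -/
private theorem LIII_koD_2 (h : Nat.Coprime 24 p) [NeZero (24 * p)] (hp : p.Prime) (h5 : 5 ≤ p)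
    (ez : ZMod 24) (bz : ZMod p) {b b' : ZMod p} (hb : b ≠ 0) (hb' : b' ≠ 0) :
    LIII h (koD (24 * p) 2 (pt h ez bz)) b b' = 0 := by
  obtain ⟨h2b, h3b, -, h6b, -⟩ := mul_ne_zero_facts hp h5 hb
  obtain ⟨h2b', h3b', -, h6b', -⟩ := mul_ne_zero_facts hp h5 hb'
  simp only [LIII, Gam4,
    hat_koD_dvd h (by norm_num : 2 ∣ 24) (by norm_num) _ _ hb,
    hat_koD_dvd h (by norm_num : 2 ∣ 24) (by norm_num) _ _ h2b,
    hat_koD_dvd h (by norm_num : 2 ∣ 24) (by norm_num) _ _ h3b,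
    hat_koD_dvd h (by norm_num : 2 ∣ 24) (by norm_num) _ _ h6b,
    hat_koD_dvd h (by norm_num : 2 ∣ 24) (by norm_num) _ _ hb',
    hat_koD_dvd h (by norm_num : 2 ∣ 24) (by norm_num) _ _ h2b',
    hat_koD_dvd h (by norm_num : 2 ∣ 24) (by norm_num) _ _ h3b',
    hat_koD_dvd h (by norm_num : 2 ∣ 24) (by norm_num) _ _ h6b']
  fin_cases ez <;> simp +decide

/-- `LIII` kills `D_{3,z}`. [folklore] -/
private theorem LIII_koD_3 (h : Nat.Coprime 24 p) [NeZero (24 * p)] (hp : p.Prime) (h5 : 5 ≤ p)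
    (ez : ZMod 24) (bz : ZMod p) {b b' : ZMod p} (hb : b ≠ 0) (hb' : b' ≠ 0) :
    LIII h (koD (24 * p) 3 (pt h ez bz)) b b' = 0 := by
  obtain ⟨h2b, h3b, -, h6b, -⟩ := mul_ne_zero_facts hp h5 hb
  obtain ⟨h2b', h3b', -, h6b', -⟩ := mul_ne_zero_facts hp h5 hb'
  simp only [LIII, Gam4,
    hat_koD_dvd h (by norm_num : 3 ∣ 24) (by norm_num) _ _ hb,
    hat_koD_dvd h (by norm_num : 3 ∣ 24) (by norm_num) _ _ h2b,
    hat_koD_dvd h (by norm_num : 3 ∣ 24) (by norm_num) _ _ h3b,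
    hat_koD_dvd h (by norm_num : 3 ∣ 24) (by norm_num) _ _ h6b,
    hat_koD_dvd h (by norm_num : 3 ∣ 24) (by norm_num) _ _ hb',
    hat_koD_dvd h (by norm_num : 3 ∣ 24) (by norm_num) _ _ h2b',
    hat_koD_dvd h (by norm_num : 3 ∣ 24) (by norm_num) _ _ h3b',
    hat_koD_dvd h (by norm_num : 3 ∣ 24) (by norm_num) _ _ h6b']
  fin_cases ez <;> simp +decide

/-- `LIII` kills `D_{4,z}`. [folklore] -/
private theorem LIII_koD_4 (h : Nat.Coprime 24 p) [NeZero (24 * p)] (hp : p.Prime) (h5 : 5 ≤ p)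
    (ez : ZMod 24) (bz : ZMod p) {b b' : ZMod p} (hb : b ≠ 0) (hb' : b' ≠ 0) :
    LIII h (koD (24 * p) 4 (pt h ez bz)) b b' = 0 := by
  obtain ⟨h2b, h3b, -, h6b, -⟩ := mul_ne_zero_facts hp h5 hb
  obtain ⟨h2b', h3b', -, h6b', -⟩ := mul_ne_zero_facts hp h5 hb'
  simp only [LIII, Gam4,
    hat_koD_dvd h (by norm_num : 4 ∣ 24) (by norm_num) _ _ hb,
    hat_koD_dvd h (by norm_num : 4 ∣ 24) (by norm_num) _ _ h2b,
    hat_koD_dvd h (by norm_num : 4 ∣ 24) (by norm_num) _ _ h3b,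
    hat_koD_dvd h (by norm_num : 4 ∣ 24) (by norm_num) _ _ h6b,
    hat_koD_dvd h (by norm_num : 4 ∣ 24) (by norm_num) _ _ hb',
    hat_koD_dvd h (by norm_num : 4 ∣ 24) (by norm_num) _ _ h2b',
    hat_koD_dvd h (by norm_num : 4 ∣ 24) (by norm_num) _ _ h3b',
    hat_koD_dvd h (by norm_num : 4 ∣ 24) (by norm_num) _ _ h6b']
  fin_cases ez <;> simp +decide

/-- `LIII` kills `D_{6,z}`. [folklore] -/
private theorem LIII_koD_6 (h : Nat.Coprime 24 p) [NeZero (24 * p)] (hp : p.Prime) (h5 : 5 ≤ p)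
    (ez : ZMod 24) (bz : ZMod p) {b b' : ZMod p} (hb : b ≠ 0) (hb' : b' ≠ 0) :
    LIII h (koD (24 * p) 6 (pt h ez bz)) b b' = 0 := by
  obtain ⟨h2b, h3b, -, h6b, -⟩ := mul_ne_zero_facts hp h5 hb
  obtain ⟨h2b', h3b', -, h6b', -⟩ := mul_ne_zero_facts hp h5 hb'
  simp only [LIII, Gam4,
    hat_koD_dvd h (by norm_num : 6 ∣ 24) (by norm_num) _ _ hb,
    hat_koD_dvd h (by norm_num : 6 ∣ 24) (by norm_num) _ _ h2b,
    hat_koD_dvd h (by norm_num : 6 ∣ 24) (by norm_num) _ _ h3b,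
    hat_koD_dvd h (by norm_num : 6 ∣ 24) (by norm_num) _ _ h6b,
    hat_koD_dvd h (by norm_num : 6 ∣ 24) (by norm_num) _ _ hb',
    hat_koD_dvd h (by norm_num : 6 ∣ 24) (by norm_num) _ _ h2b',
    hat_koD_dvd h (by norm_num : 6 ∣ 24) (by norm_num) _ _ h3b',
    hat_koD_dvd h (by norm_num : 6 ∣ 24) (by norm_num) _ _ h6b']
  fin_cases ez <;> simp +decide

/-- `LIII` kills `D_{8,z}`. [folklore] -/
private theorem LIII_koD_8 (h : Nat.Coprime 24 p) [NeZero (24 * p)] (hp : p.Prime) (h5 : 5 ≤ p)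
    (ez : ZMod 24) (bz : ZMod p) {b b' : ZMod p} (hb : b ≠ 0) (hb' : b' ≠ 0) :
    LIII h (koD (24 * p) 8 (pt h ez bz)) b b' = 0 := by
  obtain ⟨h2b, h3b, -, h6b, -⟩ := mul_ne_zero_facts hp h5 hb
  obtain ⟨h2b', h3b', -, h6b', -⟩ := mul_ne_zero_facts hp h5 hb'
  simp only [LIII, Gam4,
    hat_koD_dvd h (by norm_num : 8 ∣ 24) (by norm_num) _ _ hb,
    hat_koD_dvd h (by norm_num : 8 ∣ 24) (by norm_num) _ _ h2b,
    hat_koD_dvd h (by norm_num : 8 ∣ 24) (by norm_num) _ _ h3b,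
    hat_koD_dvd h (by norm_num : 8 ∣ 24) (by norm_num) _ _ h6b,
    hat_koD_dvd h (by norm_num : 8 ∣ 24) (by norm_num) _ _ hb',
    hat_koD_dvd h (by norm_num : 8 ∣ 24) (by norm_num) _ _ h2b',
    hat_koD_dvd h (by norm_num : 8 ∣ 24) (by norm_num) _ _ h3b',
    hat_koD_dvd h (by norm_num : 8 ∣ 24) (by norm_num) _ _ h6b']
  fin_cases ez <;> simp +decide

/-- `LIII` kills `D_{12,z}`. [folklore] -/
private theorem LIII_koD_12 (h : Nat.Coprime 24 p) [NeZero (24 * p)] (hp : p.Prime) (h5 : 5 ≤ p)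
    (ez : ZMod 24) (bz : ZMod p) {b b' : ZMod p} (hb : b ≠ 0) (hb' : b' ≠ 0) :
    LIII h (koD (24 * p) 12 (pt h ez bz)) b b' = 0 := by
  obtain ⟨h2b, h3b, -, h6b, -⟩ := mul_ne_zero_facts hp h5 hb
  obtain ⟨h2b', h3b', -, h6b', -⟩ := mul_ne_zero_facts hp h5 hb'
  simp only [LIII, Gam4,
    hat_koD_dvd h (by norm_num : 12 ∣ 24) (by norm_num) _ _ hb,
    hat_koD_dvd h (by norm_num : 12 ∣ 24) (by norm_num) _ _ h2b,
    hat_koD_dvd h (by norm_num : 12 ∣ 24) (by norm_num) _ _ h3b,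
    hat_koD_dvd h (by norm_num : 12 ∣ 24) (by norm_num) _ _ h6b,
    hat_koD_dvd h (by norm_num : 12 ∣ 24) (by norm_num) _ _ hb',
    hat_koD_dvd h (by norm_num : 12 ∣ 24) (by norm_num) _ _ h2b',
    hat_koD_dvd h (by norm_num : 12 ∣ 24) (by norm_num) _ _ h3b',
    hat_koD_dvd h (by norm_num : 12 ∣ 24) (by norm_num) _ _ h6b']
  fin_cases ez <;> simp +decide

/-- `LIII` kills `D_{24p,z} = 0`. [folklore] -/
private theorem LIII_koD_top (h : Nat.Coprime 24 p) [NeZero (24 * p)] (z : ZMod (24 * p)) (b b' : ZMod p) :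
    LIII h (koD (24 * p) (24 * p) z) b b' = 0 := by
  simp only [LIII, Gam4, hat, koD_top, sub_self]

/-- `LIII` kills `D_{p,z}`. [folklore] -/
private theorem LIII_koD_P (h : Nat.Coprime 24 p) [NeZero (24 * p)] (hp : p.Prime)
    (ez : ZMod 24) (bz : ZMod p) (b b' : ZMod p) :
    LIII h (koD (24 * p) p (pt h ez bz)) b b' = 0 := by
  simp only [LIII, Gam4, hat_koD_P h hp]
  fin_cases ez <;> simp +decide

/-- `LIII` kills `D_{2p,z}`. [folklore] -/
private theorem LIII_koD_2P (h : Nat.Coprime 24 p) [NeZero (24 * p)] (hp : p.Prime) (h5 : 5 ≤ p)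
    (ez : ZMod 24) (bz : ZMod p) (b b' : ZMod p) :
    LIII h (koD (24 * p) (2 * p) (pt h ez bz)) b b' = 0 := by
  simp only [LIII, Gam4, hat_koD_mulP h hp (k := 2) (j := 12) (by norm_num), Nat.cast_ofNat]
  fin_cases ez <;> simp +decide [
    (co_12_1 (p := p) b bz).1, (co_12_1 (p := p) b bz).2, (cc_12_2 (p := p) hp h5 b bz).1, (cc_12_2 (p := p) hp h5 b bz).2,
    (cc_12_3 (p := p) hp h5 b bz).1, (cc_12_3 (p := p) hp h5 b bz).2, (cc_12_6 (p := p) hp h5 b bz).1, (cc_12_6 (p := p) hp h5 b bz).2,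
    (co_12_1 (p := p) b' bz).1, (co_12_1 (p := p) b' bz).2, (cc_12_2 (p := p) hp h5 b' bz).1, (cc_12_2 (p := p) hp h5 b' bz).2,
    (cc_12_3 (p := p) hp h5 b' bz).1, (cc_12_3 (p := p) hp h5 b' bz).2, (cc_12_6 (p := p) hp h5 b' bz).1, (cc_12_6 (p := p) hp h5 b' bz).2]

/-- `LIII` kills `D_{3p,z}`. [folklore] -/
private theorem LIII_koD_3P (h : Nat.Coprime 24 p) [NeZero (24 * p)] (hp : p.Prime) (h5 : 5 ≤ p)
    (ez : ZMod 24) (bz : ZMod p) (b b' : ZMod p) :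
    LIII h (koD (24 * p) (3 * p) (pt h ez bz)) b b' = 0 := by
  simp only [LIII, Gam4, hat_koD_mulP h hp (k := 3) (j := 8) (by norm_num), Nat.cast_ofNat]
  fin_cases ez <;> simp +decide [
    (co_8_1 (p := p) b bz).1, (co_8_1 (p := p) b bz).2, (cc_8_2 (p := p) hp h5 b bz).1, (cc_8_2 (p := p) hp h5 b bz).2,
    (co_8_3 (p := p) b bz).1, (co_8_3 (p := p) b bz).2, (cc_8_6 (p := p) hp h5 b bz).1, (cc_8_6 (p := p) hp h5 b bz).2,
    (co_8_1 (p := p) b' bz).1, (co_8_1 (p := p) b' bz).2, (cc_8_2 (p := p) hp h5 b' bz).1, (cc_8_2 (p := p) hp h5 b' bz).2,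
    (co_8_3 (p := p) b' bz).1, (co_8_3 (p := p) b' bz).2, (cc_8_6 (p := p) hp h5 b' bz).1, (cc_8_6 (p := p) hp h5 b' bz).2] <;> ring

/-- `LIII` kills `D_{4p,z}`. [folklore] -/
private theorem LIII_koD_4P (h : Nat.Coprime 24 p) [NeZero (24 * p)] (hp : p.Prime) (h5 : 5 ≤ p)
    (ez : ZMod 24) (bz : ZMod p) (b b' : ZMod p) :
    LIII h (koD (24 * p) (4 * p) (pt h ez bz)) b b' = 0 := by
  simp only [LIII, Gam4, hat_koD_mulP h hp (k := 4) (j := 6) (by norm_num), Nat.cast_ofNat]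
  fin_cases ez <;> simp +decide [
    (co_6_1 (p := p) b bz).1, (co_6_1 (p := p) b bz).2, (cc_6_2 (p := p) hp h5 b bz).1, (cc_6_2 (p := p) hp h5 b bz).2,
    (cc_6_3 (p := p) hp h5 b bz).1, (cc_6_3 (p := p) hp h5 b bz).2, (cc_6_6 (p := p) hp h5 b bz).1, (cc_6_6 (p := p) hp h5 b bz).2,
    (co_6_1 (p := p) b' bz).1, (co_6_1 (p := p) b' bz).2, (cc_6_2 (p := p) hp h5 b' bz).1, (cc_6_2 (p := p) hp h5 b' bz).2,
    (cc_6_3 (p := p) hp h5 b' bz).1, (cc_6_3 (p := p) hp h5 b' bz).2, (cc_6_6 (p := p) hp h5 b' bz).1, (cc_6_6 (p := p) hp h5 b' bz).2] <;> ring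

/-- `LIII` kills `D_{6p,z}`. [folklore] -/
private theorem LIII_koD_6P (h : Nat.Coprime 24 p) [NeZero (24 * p)] (hp : p.Prime) (h5 : 5 ≤ p)
    (ez : ZMod 24) (bz : ZMod p) (b b' : ZMod p) :
    LIII h (koD (24 * p) (6 * p) (pt h ez bz)) b b' = 0 := by
  simp only [LIII, Gam4, hat_koD_mulP h hp (k := 6) (j := 4) (by norm_num), Nat.cast_ofNat]
  fin_cases ez <;> simp +decide [
    (co_4_1 (p := p) b bz).1, (co_4_1 (p := p) b bz).2, (cc_4_2 (p := p) hp h5 b bz).1, (cc_4_2 (p := p) hp h5 b bz).2,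
    (co_4_3 (p := p) b bz).1, (co_4_3 (p := p) b bz).2, (cc_4_6 (p := p) hp h5 b bz).1, (cc_4_6 (p := p) hp h5 b bz).2,
    (co_4_1 (p := p) b' bz).1, (co_4_1 (p := p) b' bz).2, (cc_4_2 (p := p) hp h5 b' bz).1, (cc_4_2 (p := p) hp h5 b' bz).2,
    (co_4_3 (p := p) b' bz).1, (co_4_3 (p := p) b' bz).2, (cc_4_6 (p := p) hp h5 b' bz).1, (cc_4_6 (p := p) hp h5 b' bz).2] <;> ring

/-- `LIII` kills `D_{8p,z}`. [folklore] -/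
private theorem LIII_koD_8P (h : Nat.Coprime 24 p) [NeZero (24 * p)] (hp : p.Prime) (h5 : 5 ≤ p)
    (ez : ZMod 24) (bz : ZMod p) (b b' : ZMod p) :
    LIII h (koD (24 * p) (8 * p) (pt h ez bz)) b b' = 0 := by
  simp only [LIII, Gam4, hat_koD_mulP h hp (k := 8) (j := 3) (by norm_num), Nat.cast_ofNat]
  fin_cases ez <;> simp +decide [
    (co_3_1 (p := p) b bz).1, (co_3_1 (p := p) b bz).2, (co_3_2 (p := p) b bz).1, (co_3_2 (p := p) b bz).2,
    (cc_3_3 (p := p) hp h5 b bz).1, (cc_3_3 (p := p) hp h5 b bz).2, (cc_3_6 (p := p) hp h5 b bz).1, (cc_3_6 (p := p) hp h5 b bz).2,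
    (co_3_1 (p := p) b' bz).1, (co_3_1 (p := p) b' bz).2, (co_3_2 (p := p) b' bz).1, (co_3_2 (p := p) b' bz).2,
    (cc_3_3 (p := p) hp h5 b' bz).1, (cc_3_3 (p := p) hp h5 b' bz).2, (cc_3_6 (p := p) hp h5 b' bz).1, (cc_3_6 (p := p) hp h5 b' bz).2] <;> ring

/-- `LIII` kills `D_{12p,z}`. [folklore] -/
private theorem LIII_koD_12P (h : Nat.Coprime 24 p) [NeZero (24 * p)] (hp : p.Prime) (h5 : 5 ≤ p)
    (ez : ZMod 24) (bz : ZMod p) (b b' : ZMod p) :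
    LIII h (koD (24 * p) (12 * p) (pt h ez bz)) b b' = 0 := by
  simp only [LIII, Gam4, hat_koD_mulP h hp (k := 12) (j := 2) (by norm_num), Nat.cast_ofNat]
  fin_cases ez <;> simp +decide [
    (co_2_1 (p := p) b bz).1, (co_2_1 (p := p) b bz).2, (cc_2_2 (p := p) hp h5 b bz).1, (cc_2_2 (p := p) hp h5 b bz).2,
    (co_2_3 (p := p) b bz).1, (co_2_3 (p := p) b bz).2, (cc_2_6 (p := p) hp h5 b bz).1, (cc_2_6 (p := p) hp h5 b bz).2,
    (co_2_1 (p := p) b' bz).1, (co_2_1 (p := p) b' bz).2, (cc_2_2 (p := p) hp h5 b' bz).1, (cc_2_2 (p := p) hp h5 b' bz).2,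
    (co_2_3 (p := p) b' bz).1, (co_2_3 (p := p) b' bz).2, (cc_2_6 (p := p) hp h5 b' bz).1, (cc_2_6 (p := p) hp h5 b' bz).2] <;> ring

/-- `LIII` kills `D_{24,z}`. [folklore] -/
private theorem LIII_koD_24 (h : Nat.Coprime 24 p) [NeZero (24 * p)] (hp : p.Prime) (h5 : 5 ≤ p)
    (ez : ZMod 24) (bz : ZMod p) {b b' : ZMod p} (hb : b ≠ 0) (hb' : b' ≠ 0) :
    LIII h (koD (24 * p) 24 (pt h ez bz)) b b' = 0 := by
  obtain ⟨h2b, h3b, -, h6b, -⟩ := mul_ne_zero_facts hp h5 hb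
  obtain ⟨h2b', h3b', -, h6b', -⟩ := mul_ne_zero_facts hp h5 hb'
  simp only [LIII, Gam4,
    hat_koD_dvd h (by norm_num : 24 ∣ 24) (by norm_num) _ _ hb,
    hat_koD_dvd h (by norm_num : 24 ∣ 24) (by norm_num) _ _ h2b,
    hat_koD_dvd h (by norm_num : 24 ∣ 24) (by norm_num) _ _ h3b,
    hat_koD_dvd h (by norm_num : 24 ∣ 24) (by norm_num) _ _ h6b,
    hat_koD_dvd h (by norm_num : 24 ∣ 24) (by norm_num) _ _ hb',
    hat_koD_dvd h (by norm_num : 24 ∣ 24) (by norm_num) _ _ h2b',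
    hat_koD_dvd h (by norm_num : 24 ∣ 24) (by norm_num) _ _ h3b',
    hat_koD_dvd h (by norm_num : 24 ∣ 24) (by norm_num) _ _ h6b']
  fin_cases ez <;> simp +decide

/-- **`LIII` kills every distribution vector.** [folklore] -/
private theorem LIII_koD (h : Nat.Coprime 24 p) [NeZero (24 * p)] (hp : p.Prime) (h5 : 5 ≤ p) {M : ℕ}
    (hM : M ∈ (24 * p).divisors) (z : ZMod (24 * p)) {b b' : ZMod p} (hb : b ≠ 0) (hb' : b' ≠ 0) :
    LIII h (koD (24 * p) M z) b b' = 0 := by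
  obtain ⟨ez, bz, rfl⟩ : ∃ ez bz, z = pt h ez bz := ⟨_, _, (pt_crt h z).symm⟩
  rcases eq_of_dvd_twentyFour_mul_prime hp h5 (Nat.dvd_of_mem_divisors hM) with
    rfl | rfl | rfl | rfl | rfl | rfl | rfl | rfl | rfl | rfl | rfl | rfl | rfl | rfl | rfl | hM24
  · exact LIII_koD_1 h hp h5 ez bz hb hb'
  · exact LIII_koD_2 h hp h5 ez bz hb hb'
  · exact LIII_koD_3 h hp h5 ez bz hb hb'
  · exact LIII_koD_4 h hp h5 ez bz hb hb'
  · exact LIII_koD_6 h hp h5 ez bz hb hb'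
  · exact LIII_koD_8 h hp h5 ez bz hb hb'
  · exact LIII_koD_12 h hp h5 ez bz hb hb'
  · -- `k = 24`: the congruence is mod `24`, the point lies in the fibre `0`
    exact LIII_koD_24 h hp h5 ez bz hb hb'
  · exact LIII_koD_P h hp ez bz b b'
  · exact LIII_koD_2P h hp h5 ez bz b b'
  · exact LIII_koD_3P h hp h5 ez bz b b'
  · exact LIII_koD_4P h hp h5 ez bz b b'
  · exact LIII_koD_6P h hp h5 ez bz b b'
  · exact LIII_koD_8P h hp h5 ez bz b b'
  · exact LIII_koD_12P h hp h5 ez bz b b'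
  · rw [hM24]; exact LIII_koD_top h _ b b'

/-- `LIV` kills `D_{1,z}`. [folklore] -/
private theorem LIV_koD_1 (h : Nat.Coprime 24 p) [NeZero (24 * p)] (hp : p.Prime) (h5 : 5 ≤ p)
    (ez : ZMod 24) (bz : ZMod p) {b b' : ZMod p} (hb : b ≠ 0) (hb' : b' ≠ 0) :
    LIV h (koD (24 * p) 1 (pt h ez bz)) b b' = 0 := by
  obtain ⟨h2b, -, h4b, -, h8b⟩ := mul_ne_zero_facts hp h5 hb
  obtain ⟨h2b', -, h4b', -, h8b'⟩ := mul_ne_zero_facts hp h5 hb'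
  simp only [LIV, Gam3,
    hat_koD_dvd h (by norm_num : 1 ∣ 24) (by norm_num) _ _ hb,
    hat_koD_dvd h (by norm_num : 1 ∣ 24) (by norm_num) _ _ h2b,
    hat_koD_dvd h (by norm_num : 1 ∣ 24) (by norm_num) _ _ h4b,
    hat_koD_dvd h (by norm_num : 1 ∣ 24) (by norm_num) _ _ h8b,
    hat_koD_dvd h (by norm_num : 1 ∣ 24) (by norm_num) _ _ hb',
    hat_koD_dvd h (by norm_num : 1 ∣ 24) (by norm_num) _ _ h2b',
    hat_koD_dvd h (by norm_num : 1 ∣ 24) (by norm_num) _ _ h4b',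
    hat_koD_dvd h (by norm_num : 1 ∣ 24) (by norm_num) _ _ h8b']
  fin_cases ez <;> simp +decide

/-- `LIV` kills `D_{2,z}`. [folklore] -/
private theorem LIV_koD_2 (h : Nat.Coprime 24 p) [NeZero (24 * p)] (hp : p.Prime) (h5 : 5 ≤ p)
    (ez : ZMod 24) (bz : ZMod p) {b b' : ZMod p} (hb : b ≠ 0) (hb' : b' ≠ 0) :
    LIV h (koD (24 * p) 2 (pt h ez bz)) b b' = 0 := by
  obtain ⟨h2b, -, h4b, -, h8b⟩ := mul_ne_zero_facts hp h5 hb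
  obtain ⟨h2b', -, h4b', -, h8b'⟩ := mul_ne_zero_facts hp h5 hb'
  simp only [LIV, Gam3,
    hat_koD_dvd h (by norm_num : 2 ∣ 24) (by norm_num) _ _ hb,
    hat_koD_dvd h (by norm_num : 2 ∣ 24) (by norm_num) _ _ h2b,
    hat_koD_dvd h (by norm_num : 2 ∣ 24) (by norm_num) _ _ h4b,
    hat_koD_dvd h (by norm_num : 2 ∣ 24) (by norm_num) _ _ h8b,
    hat_koD_dvd h (by norm_num : 2 ∣ 24) (by norm_num) _ _ hb',
    hat_koD_dvd h (by norm_num : 2 ∣ 24) (by norm_num) _ _ h2b',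
    hat_koD_dvd h (by norm_num : 2 ∣ 24) (by norm_num) _ _ h4b',
    hat_koD_dvd h (by norm_num : 2 ∣ 24) (by norm_num) _ _ h8b']
  fin_cases ez <;> simp +decide

/-- `LIV` kills `D_{3,z}`. [folklore] -/
private theorem LIV_koD_3 (h : Nat.Coprime 24 p) [NeZero (24 * p)] (hp : p.Prime) (h5 : 5 ≤ p)
    (ez : ZMod 24) (bz : ZMod p) {b b' : ZMod p} (hb : b ≠ 0) (hb' : b' ≠ 0) :
    LIV h (koD (24 * p) 3 (pt h ez bz)) b b' = 0 := by
  obtain ⟨h2b, -, h4b, -, h8b⟩ := mul_ne_zero_facts hp h5 hb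
  obtain ⟨h2b', -, h4b', -, h8b'⟩ := mul_ne_zero_facts hp h5 hb'
  simp only [LIV, Gam3,
    hat_koD_dvd h (by norm_num : 3 ∣ 24) (by norm_num) _ _ hb,
    hat_koD_dvd h (by norm_num : 3 ∣ 24) (by norm_num) _ _ h2b,
    hat_koD_dvd h (by norm_num : 3 ∣ 24) (by norm_num) _ _ h4b,
    hat_koD_dvd h (by norm_num : 3 ∣ 24) (by norm_num) _ _ h8b,
    hat_koD_dvd h (by norm_num : 3 ∣ 24) (by norm_num) _ _ hb',
    hat_koD_dvd h (by norm_num : 3 ∣ 24) (by norm_num) _ _ h2b',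
    hat_koD_dvd h (by norm_num : 3 ∣ 24) (by norm_num) _ _ h4b',
    hat_koD_dvd h (by norm_num : 3 ∣ 24) (by norm_num) _ _ h8b']
  fin_cases ez <;> simp +decide

/-- `LIV` kills `D_{4,z}`. [folklore] -/
private theorem LIV_koD_4 (h : Nat.Coprime 24 p) [NeZero (24 * p)] (hp : p.Prime) (h5 : 5 ≤ p)
    (ez : ZMod 24) (bz : ZMod p) {b b' : ZMod p} (hb : b ≠ 0) (hb' : b' ≠ 0) :
    LIV h (koD (24 * p) 4 (pt h ez bz)) b b' = 0 := by
  obtain ⟨h2b, -, h4b, -, h8b⟩ := mul_ne_zero_facts hp h5 hb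
  obtain ⟨h2b', -, h4b', -, h8b'⟩ := mul_ne_zero_facts hp h5 hb'
  simp only [LIV, Gam3,
    hat_koD_dvd h (by norm_num : 4 ∣ 24) (by norm_num) _ _ hb,
    hat_koD_dvd h (by norm_num : 4 ∣ 24) (by norm_num) _ _ h2b,
    hat_koD_dvd h (by norm_num : 4 ∣ 24) (by norm_num) _ _ h4b,
    hat_koD_dvd h (by norm_num : 4 ∣ 24) (by norm_num) _ _ h8b,
    hat_koD_dvd h (by norm_num : 4 ∣ 24) (by norm_num) _ _ hb',
    hat_koD_dvd h (by norm_num : 4 ∣ 24) (by norm_num) _ _ h2b',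
    hat_koD_dvd h (by norm_num : 4 ∣ 24) (by norm_num) _ _ h4b',
    hat_koD_dvd h (by norm_num : 4 ∣ 24) (by norm_num) _ _ h8b']
  fin_cases ez <;> simp +decide

/-- `LIV` kills `D_{6,z}`. [folklore] -/
private theorem LIV_koD_6 (h : Nat.Coprime 24 p) [NeZero (24 * p)] (hp : p.Prime) (h5 : 5 ≤ p)
    (ez : ZMod 24) (bz : ZMod p) {b b' : ZMod p} (hb : b ≠ 0) (hb' : b' ≠ 0) :
    LIV h (koD (24 * p) 6 (pt h ez bz)) b b' = 0 := by
  obtain ⟨h2b, -, h4b, -, h8b⟩ := mul_ne_zero_facts hp h5 hb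
  obtain ⟨h2b', -, h4b', -, h8b'⟩ := mul_ne_zero_facts hp h5 hb'
  simp only [LIV, Gam3,
    hat_koD_dvd h (by norm_num : 6 ∣ 24) (by norm_num) _ _ hb,
    hat_koD_dvd h (by norm_num : 6 ∣ 24) (by norm_num) _ _ h2b,
    hat_koD_dvd h (by norm_num : 6 ∣ 24) (by norm_num) _ _ h4b,
    hat_koD_dvd h (by norm_num : 6 ∣ 24) (by norm_num) _ _ h8b,
    hat_koD_dvd h (by norm_num : 6 ∣ 24) (by norm_num) _ _ hb',
    hat_koD_dvd h (by norm_num : 6 ∣ 24) (by norm_num) _ _ h2b',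
    hat_koD_dvd h (by norm_num : 6 ∣ 24) (by norm_num) _ _ h4b',
    hat_koD_dvd h (by norm_num : 6 ∣ 24) (by norm_num) _ _ h8b']
  fin_cases ez <;> simp +decide

/-- `LIV` kills `D_{8,z}`. [folklore] -/
private theorem LIV_koD_8 (h : Nat.Coprime 24 p) [NeZero (24 * p)] (hp : p.Prime) (h5 : 5 ≤ p)
    (ez : ZMod 24) (bz : ZMod p) {b b' : ZMod p} (hb : b ≠ 0) (hb' : b' ≠ 0) :
    LIV h (koD (24 * p) 8 (pt h ez bz)) b b' = 0 := by
  obtain ⟨h2b, -, h4b, -, h8b⟩ := mul_ne_zero_facts hp h5 hb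
  obtain ⟨h2b', -, h4b', -, h8b'⟩ := mul_ne_zero_facts hp h5 hb'
  simp only [LIV, Gam3,
    hat_koD_dvd h (by norm_num : 8 ∣ 24) (by norm_num) _ _ hb,
    hat_koD_dvd h (by norm_num : 8 ∣ 24) (by norm_num) _ _ h2b,
    hat_koD_dvd h (by norm_num : 8 ∣ 24) (by norm_num) _ _ h4b,
    hat_koD_dvd h (by norm_num : 8 ∣ 24) (by norm_num) _ _ h8b,
    hat_koD_dvd h (by norm_num : 8 ∣ 24) (by norm_num) _ _ hb',
    hat_koD_dvd h (by norm_num : 8 ∣ 24) (by norm_num) _ _ h2b',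
    hat_koD_dvd h (by norm_num : 8 ∣ 24) (by norm_num) _ _ h4b',
    hat_koD_dvd h (by norm_num : 8 ∣ 24) (by norm_num) _ _ h8b']
  fin_cases ez <;> simp +decide

/-- `LIV` kills `D_{12,z}`. [folklore] -/
private theorem LIV_koD_12 (h : Nat.Coprime 24 p) [NeZero (24 * p)] (hp : p.Prime) (h5 : 5 ≤ p)
    (ez : ZMod 24) (bz : ZMod p) {b b' : ZMod p} (hb : b ≠ 0) (hb' : b' ≠ 0) :
    LIV h (koD (24 * p) 12 (pt h ez bz)) b b' = 0 := by
  obtain ⟨h2b, -, h4b, -, h8b⟩ := mul_ne_zero_facts hp h5 hb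
  obtain ⟨h2b', -, h4b', -, h8b'⟩ := mul_ne_zero_facts hp h5 hb'
  simp only [LIV, Gam3,
    hat_koD_dvd h (by norm_num : 12 ∣ 24) (by norm_num) _ _ hb,
    hat_koD_dvd h (by norm_num : 12 ∣ 24) (by norm_num) _ _ h2b,
    hat_koD_dvd h (by norm_num : 12 ∣ 24) (by norm_num) _ _ h4b,
    hat_koD_dvd h (by norm_num : 12 ∣ 24) (by norm_num) _ _ h8b,
    hat_koD_dvd h (by norm_num : 12 ∣ 24) (by norm_num) _ _ hb',
    hat_koD_dvd h (by norm_num : 12 ∣ 24) (by norm_num) _ _ h2b',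
    hat_koD_dvd h (by norm_num : 12 ∣ 24) (by norm_num) _ _ h4b',
    hat_koD_dvd h (by norm_num : 12 ∣ 24) (by norm_num) _ _ h8b']
  fin_cases ez <;> simp +decide

/-- `LIV` kills `D_{24p,z} = 0`. [folklore] -/
private theorem LIV_koD_top (h : Nat.Coprime 24 p) [NeZero (24 * p)] (z : ZMod (24 * p)) (b b' : ZMod p) :
    LIV h (koD (24 * p) (24 * p) z) b b' = 0 := by
  simp only [LIV, Gam3, hat, koD_top, sub_self]

/-- `LIV` kills `D_{p,z}`. [folklore] -/
private theorem LIV_koD_P (h : Nat.Coprime 24 p) [NeZero (24 * p)] (hp : p.Prime)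
    (ez : ZMod 24) (bz : ZMod p) (b b' : ZMod p) :
    LIV h (koD (24 * p) p (pt h ez bz)) b b' = 0 := by
  simp only [LIV, Gam3, hat_koD_P h hp]
  fin_cases ez <;> simp +decide

/-- `LIV` kills `D_{2p,z}`. [folklore] -/
private theorem LIV_koD_2P (h : Nat.Coprime 24 p) [NeZero (24 * p)] (hp : p.Prime) (h5 : 5 ≤ p)
    (ez : ZMod 24) (bz : ZMod p) (b b' : ZMod p) :
    LIV h (koD (24 * p) (2 * p) (pt h ez bz)) b b' = 0 := by
  simp only [LIV, Gam3, hat_koD_mulP h hp (k := 2) (j := 12) (by norm_num), Nat.cast_ofNat]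
  fin_cases ez <;> simp +decide [
    (co_12_1 (p := p) b bz).1, (co_12_1 (p := p) b bz).2, (cc_12_2 (p := p) hp h5 b bz).1, (cc_12_2 (p := p) hp h5 b bz).2,
    (cc_12_4 (p := p) hp h5 b bz).1, (cc_12_4 (p := p) hp h5 b bz).2, (cc_12_8 (p := p) hp h5 b bz).1, (cc_12_8 (p := p) hp h5 b bz).2,
    (co_12_1 (p := p) b' bz).1, (co_12_1 (p := p) b' bz).2, (cc_12_2 (p := p) hp h5 b' bz).1, (cc_12_2 (p := p) hp h5 b' bz).2,
    (cc_12_4 (p := p) hp h5 b' bz).1, (cc_12_4 (p := p) hp h5 b' bz).2, (cc_12_8 (p := p) hp h5 b' bz).1, (cc_12_8 (p := p) hp h5 b' bz).2]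

set_option maxHeartbeats 400000 in
/-- `LIV` kills `D_{3p,z}`. [folklore] -/
private theorem LIV_koD_3P (h : Nat.Coprime 24 p) [NeZero (24 * p)] (hp : p.Prime) (h5 : 5 ≤ p)
    (ez : ZMod 24) (bz : ZMod p) (b b' : ZMod p) :
    LIV h (koD (24 * p) (3 * p) (pt h ez bz)) b b' = 0 := by
  simp only [LIV, Gam3, hat_koD_mulP h hp (k := 3) (j := 8) (by norm_num), Nat.cast_ofNat]
  fin_cases ez <;> simp +decide [
    (co_8_1 (p := p) b bz).1, (co_8_1 (p := p) b bz).2, (cc_8_2 (p := p) hp h5 b bz).1, (cc_8_2 (p := p) hp h5 b bz).2,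
    (cc_8_4 (p := p) hp h5 b bz).1, (cc_8_4 (p := p) hp h5 b bz).2, (cc_8_8 (p := p) hp h5 b bz).1, (cc_8_8 (p := p) hp h5 b bz).2,
    (co_8_1 (p := p) b' bz).1, (co_8_1 (p := p) b' bz).2, (cc_8_2 (p := p) hp h5 b' bz).1, (cc_8_2 (p := p) hp h5 b' bz).2,
    (cc_8_4 (p := p) hp h5 b' bz).1, (cc_8_4 (p := p) hp h5 b' bz).2, (cc_8_8 (p := p) hp h5 b' bz).1, (cc_8_8 (p := p) hp h5 b' bz).2] <;> ring

/-- `LIV` kills `D_{4p,z}`. [folklore] -/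
private theorem LIV_koD_4P (h : Nat.Coprime 24 p) [NeZero (24 * p)] (hp : p.Prime) (h5 : 5 ≤ p)
    (ez : ZMod 24) (bz : ZMod p) (b b' : ZMod p) :
    LIV h (koD (24 * p) (4 * p) (pt h ez bz)) b b' = 0 := by
  simp only [LIV, Gam3, hat_koD_mulP h hp (k := 4) (j := 6) (by norm_num), Nat.cast_ofNat]
  fin_cases ez <;> simp +decide [
    (co_6_1 (p := p) b bz).1, (co_6_1 (p := p) b bz).2, (cc_6_2 (p := p) hp h5 b bz).1, (cc_6_2 (p := p) hp h5 b bz).2,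
    (cc_6_4 (p := p) hp h5 b bz).1, (cc_6_4 (p := p) hp h5 b bz).2, (cc_6_8 (p := p) hp h5 b bz).1, (cc_6_8 (p := p) hp h5 b bz).2,
    (co_6_1 (p := p) b' bz).1, (co_6_1 (p := p) b' bz).2, (cc_6_2 (p := p) hp h5 b' bz).1, (cc_6_2 (p := p) hp h5 b' bz).2,
    (cc_6_4 (p := p) hp h5 b' bz).1, (cc_6_4 (p := p) hp h5 b' bz).2, (cc_6_8 (p := p) hp h5 b' bz).1, (cc_6_8 (p := p) hp h5 b' bz).2]

/-- `LIV` kills `D_{6p,z}`. [folklore] -/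
private theorem LIV_koD_6P (h : Nat.Coprime 24 p) [NeZero (24 * p)] (hp : p.Prime) (h5 : 5 ≤ p)
    (ez : ZMod 24) (bz : ZMod p) (b b' : ZMod p) :
    LIV h (koD (24 * p) (6 * p) (pt h ez bz)) b b' = 0 := by
  simp only [LIV, Gam3, hat_koD_mulP h hp (k := 6) (j := 4) (by norm_num), Nat.cast_ofNat]
  fin_cases ez <;> simp +decide [
    (co_4_1 (p := p) b bz).1, (co_4_1 (p := p) b bz).2, (cc_4_2 (p := p) hp h5 b bz).1, (cc_4_2 (p := p) hp h5 b bz).2,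
    (cc_4_4 (p := p) hp h5 b bz).1, (cc_4_4 (p := p) hp h5 b bz).2, (cc_4_8 (p := p) hp h5 b bz).1, (cc_4_8 (p := p) hp h5 b bz).2,
    (co_4_1 (p := p) b' bz).1, (co_4_1 (p := p) b' bz).2, (cc_4_2 (p := p) hp h5 b' bz).1, (cc_4_2 (p := p) hp h5 b' bz).2,
    (cc_4_4 (p := p) hp h5 b' bz).1, (cc_4_4 (p := p) hp h5 b' bz).2, (cc_4_8 (p := p) hp h5 b' bz).1, (cc_4_8 (p := p) hp h5 b' bz).2] <;> ring

/-- `LIV` kills `D_{8p,z}`. [folklore] -/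
private theorem LIV_koD_8P (h : Nat.Coprime 24 p) [NeZero (24 * p)] (hp : p.Prime)
    (ez : ZMod 24) (bz : ZMod p) (b b' : ZMod p) :
    LIV h (koD (24 * p) (8 * p) (pt h ez bz)) b b' = 0 := by
  simp only [LIV, Gam3, hat_koD_mulP h hp (k := 8) (j := 3) (by norm_num), Nat.cast_ofNat]
  fin_cases ez <;> simp +decide [
    (co_3_1 (p := p) b bz).1, (co_3_1 (p := p) b bz).2, (co_3_2 (p := p) b bz).1, (co_3_2 (p := p) b bz).2,
    (co_3_4 (p := p) b bz).1, (co_3_4 (p := p) b bz).2, (co_3_8 (p := p) b bz).1, (co_3_8 (p := p) b bz).2,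
    (co_3_1 (p := p) b' bz).1, (co_3_1 (p := p) b' bz).2, (co_3_2 (p := p) b' bz).1, (co_3_2 (p := p) b' bz).2,
    (co_3_4 (p := p) b' bz).1, (co_3_4 (p := p) b' bz).2, (co_3_8 (p := p) b' bz).1, (co_3_8 (p := p) b' bz).2] <;> ring

/-- `LIV` kills `D_{12p,z}`. [folklore] -/
private theorem LIV_koD_12P (h : Nat.Coprime 24 p) [NeZero (24 * p)] (hp : p.Prime) (h5 : 5 ≤ p)
    (ez : ZMod 24) (bz : ZMod p) (b b' : ZMod p) :
    LIV h (koD (24 * p) (12 * p) (pt h ez bz)) b b' = 0 := by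
  simp only [LIV, Gam3, hat_koD_mulP h hp (k := 12) (j := 2) (by norm_num), Nat.cast_ofNat]
  fin_cases ez <;> simp +decide [
    (co_2_1 (p := p) b bz).1, (co_2_1 (p := p) b bz).2, (cc_2_2 (p := p) hp h5 b bz).1, (cc_2_2 (p := p) hp h5 b bz).2,
    (cc_2_4 (p := p) hp h5 b bz).1, (cc_2_4 (p := p) hp h5 b bz).2, (cc_2_8 (p := p) hp h5 b bz).1, (cc_2_8 (p := p) hp h5 b bz).2,
    (co_2_1 (p := p) b' bz).1, (co_2_1 (p := p) b' bz).2, (cc_2_2 (p := p) hp h5 b' bz).1, (cc_2_2 (p := p) hp h5 b' bz).2,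
    (cc_2_4 (p := p) hp h5 b' bz).1, (cc_2_4 (p := p) hp h5 b' bz).2, (cc_2_8 (p := p) hp h5 b' bz).1, (cc_2_8 (p := p) hp h5 b' bz).2] <;> ring

/-- `LIV` kills `D_{24,z}`. [folklore] -/
private theorem LIV_koD_24 (h : Nat.Coprime 24 p) [NeZero (24 * p)] (hp : p.Prime) (h5 : 5 ≤ p)
    (ez : ZMod 24) (bz : ZMod p) {b b' : ZMod p} (hb : b ≠ 0) (hb' : b' ≠ 0) :
    LIV h (koD (24 * p) 24 (pt h ez bz)) b b' = 0 := by
  obtain ⟨h2b, -, h4b, -, h8b⟩ := mul_ne_zero_facts hp h5 hb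
  obtain ⟨h2b', -, h4b', -, h8b'⟩ := mul_ne_zero_facts hp h5 hb'
  simp only [LIV, Gam3,
    hat_koD_dvd h (by norm_num : 24 ∣ 24) (by norm_num) _ _ hb,
    hat_koD_dvd h (by norm_num : 24 ∣ 24) (by norm_num) _ _ h2b,
    hat_koD_dvd h (by norm_num : 24 ∣ 24) (by norm_num) _ _ h4b,
    hat_koD_dvd h (by norm_num : 24 ∣ 24) (by norm_num) _ _ h8b,
    hat_koD_dvd h (by norm_num : 24 ∣ 24) (by norm_num) _ _ hb',
    hat_koD_dvd h (by norm_num : 24 ∣ 24) (by norm_num) _ _ h2b',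
    hat_koD_dvd h (by norm_num : 24 ∣ 24) (by norm_num) _ _ h4b',
    hat_koD_dvd h (by norm_num : 24 ∣ 24) (by norm_num) _ _ h8b']
  fin_cases ez <;> simp +decide

/-- **`LIV` kills every distribution vector.** [folklore] -/
private theorem LIV_koD (h : Nat.Coprime 24 p) [NeZero (24 * p)] (hp : p.Prime) (h5 : 5 ≤ p) {M : ℕ}
    (hM : M ∈ (24 * p).divisors) (z : ZMod (24 * p)) {b b' : ZMod p} (hb : b ≠ 0) (hb' : b' ≠ 0) :
    LIV h (koD (24 * p) M z) b b' = 0 := by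
  obtain ⟨ez, bz, rfl⟩ : ∃ ez bz, z = pt h ez bz := ⟨_, _, (pt_crt h z).symm⟩
  rcases eq_of_dvd_twentyFour_mul_prime hp h5 (Nat.dvd_of_mem_divisors hM) with
    rfl | rfl | rfl | rfl | rfl | rfl | rfl | rfl | rfl | rfl | rfl | rfl | rfl | rfl | rfl | hM24
  · exact LIV_koD_1 h hp h5 ez bz hb hb'
  · exact LIV_koD_2 h hp h5 ez bz hb hb'
  · exact LIV_koD_3 h hp h5 ez bz hb hb'
  · exact LIV_koD_4 h hp h5 ez bz hb hb'
  · exact LIV_koD_6 h hp h5 ez bz hb hb'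
  · exact LIV_koD_8 h hp h5 ez bz hb hb'
  · exact LIV_koD_12 h hp h5 ez bz hb hb'
  · -- `k = 24`: the congruence is mod `24`, the point lies in the fibre `0`
    exact LIV_koD_24 h hp h5 ez bz hb hb'
  · exact LIV_koD_P h hp ez bz b b'
  · exact LIV_koD_2P h hp h5 ez bz b b'
  · exact LIV_koD_3P h hp h5 ez bz b b'
  · exact LIV_koD_4P h hp h5 ez bz b b'
  · exact LIV_koD_6P h hp h5 ez bz b b'
  · exact LIV_koD_8P h hp ez bz b b'
  · exact LIV_koD_12P h hp h5 ez bz b b'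
  · rw [hM24]; exact LIV_koD_top h _ b b'

/-! ### The five relations on Hodge multisets of level `24p` -/

/-- **Koblitz–Ogus, functional form:** a linear functional on `ℚ^{ℤ/24p}` that kills the negation-invariant functions and all
distribution vectors kills the multiplicity function of every Hodge multiset (the tree's PROVED
`KoblitzOgus.hodge_eq_combination`; as in `HodgeQuadruplesTwelvePrime`). [cite: Deligne1982HodgeCycles, Rem. 7.16 (a)] -/
private theorem functional_count_eq_zero [NeZero (24 * p)] {s : Multiset (ZMod (24 * p))} (hs : IsHodgeMultiset s)
    (L : (ZMod (24 * p) → ℚ) → ℚ)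
    (hadd : ∀ g g' : ZMod (24 * p) → ℚ, L (fun z ↦ g z + g' z) = L g + L g')
    (hmul : ∀ (a : ℚ) (g : ZMod (24 * p) → ℚ), L (fun z ↦ a * g z) = a * L g)
    (hsum : ∀ {ι : Type} (t : Finset ι) (g : ι → ZMod (24 * p) → ℚ), L (fun z ↦ ∑ i ∈ t, g i z) = ∑ i ∈ t, L (g i))
    (heven : ∀ g : ZMod (24 * p) → ℚ, (∀ z, g (-z) = g z) → L g = 0)
    (hko : ∀ M ∈ (24 * p).divisors, ∀ y : ZMod (24 * p), L (koD (24 * p) M y) = 0) :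
    L (fun w ↦ (count w s : ℚ)) = 0 := by
  classical
  obtain ⟨cr, cd, hrep⟩ := Literature.NumberTheory.Transcendental.KoblitzOgus.hodge_eq_combination
    (N := 24 * p) (fun x ↦ (count x s : ℚ)) (fun u hu ↦ hs.sum_count_mul_bern_eq_zero hu)
  have hf : (fun w ↦ (count w s : ℚ)) =
      fun w ↦ (∑ a : ZMod (24 * p), cr a * ((if a = w then (1 : ℚ) else 0) + (if -a = w then 1 else 0))) +
        ∑ M ∈ (24 * p).divisors, ∑ y : ZMod (24 * p), cd M y * koD (24 * p) M y w := funext hrep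
  rw [hf, hadd, hsum, hsum]
  have hA : ∀ a : ZMod (24 * p),
      L (fun w ↦ cr a * ((if a = w then (1 : ℚ) else 0) + (if -a = w then 1 else 0))) = 0 := fun a ↦ by
    rw [hmul, heven _ fun w ↦ ?_, mul_zero]
    rw [add_comm]
    congr 1
    · simp only [neg_inj]
    · simp only [eq_neg_iff_add_eq_zero, neg_eq_iff_add_eq_zero]
  have hB : ∀ M ∈ (24 * p).divisors, L (fun w ↦ ∑ y : ZMod (24 * p), cd M y * koD (24 * p) M y w) = 0 :=
    fun M hM ↦ by
      rw [hsum]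
      refine Finset.sum_eq_zero fun y _ ↦ ?_
      rw [hmul, hko M hM y, mul_zero]
  rw [Finset.sum_eq_zero fun a _ ↦ hA a, Finset.sum_eq_zero hB, add_zero]

/-- The relation `LPsi = 0` for the multiplicity function of a Hodge multiset of level `24p`.
[cite: Deligne1982HodgeCycles, Rem. 7.16 (a)] [cite: Aoki1983, Prop. 2.2] -/
private theorem LPsi_count_eq_zero (h : Nat.Coprime 24 p) [NeZero (24 * p)] (hp : p.Prime) (h5 : 5 ≤ p)
    {s : Multiset (ZMod (24 * p))} (hs : IsHodgeMultiset s) {b : ZMod p} (hb : b ≠ 0) :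
    LPsi h (fun w ↦ (count w s : ℚ)) b = 0 := by
  have lin := LPsi_linear h b
  exact functional_count_eq_zero hs (fun g ↦ LPsi h g b) lin.1 lin.2.1 (fun t g ↦ lin.2.2.1 t g) lin.2.2.2
    (fun M hM y ↦ LPsi_koD h hp h5 hM y hb)

/-- The relation `LChi8 = 0` for the multiplicity function of a Hodge multiset of level `24p`.
[cite: Deligne1982HodgeCycles, Rem. 7.16 (a)] [cite: Aoki1983, Prop. 2.2] -/
private theorem LChi8_count_eq_zero (h : Nat.Coprime 24 p) [NeZero (24 * p)] (hp : p.Prime) (h5 : 5 ≤ p)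
    {s : Multiset (ZMod (24 * p))} (hs : IsHodgeMultiset s) {b : ZMod p} (hb : b ≠ 0) :
    LChi8 h (fun w ↦ (count w s : ℚ)) b = 0 := by
  have lin := LChi8_linear h b
  exact functional_count_eq_zero hs (fun g ↦ LChi8 h g b) lin.1 lin.2.1 (fun t g ↦ lin.2.2.1 t g) lin.2.2.2
    (fun M hM y ↦ LChi8_koD h hp h5 hM y hb)

/-- The relation `LM8 = 0` (i.e. `GamM8(b) = GamM8(b′)`) for the multiplicity function of a Hodge multiset of level `24p`.
[cite: Deligne1982HodgeCycles, Rem. 7.16 (a)] [cite: Aoki1983, Prop. 2.2] -/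
private theorem LM8_count_eq_zero (h : Nat.Coprime 24 p) [NeZero (24 * p)] (hp : p.Prime) (h5 : 5 ≤ p)
    {s : Multiset (ZMod (24 * p))} (hs : IsHodgeMultiset s) {b b' : ZMod p} (hb : b ≠ 0) (hb' : b' ≠ 0) :
    LM8 h (fun w ↦ (count w s : ℚ)) b b' = 0 := by
  have lin := LM8_linear h b b'
  exact functional_count_eq_zero hs (fun g ↦ LM8 h g b b') lin.1 lin.2.1 (fun t g ↦ lin.2.2.1 t g) lin.2.2.2
    (fun M hM y ↦ LM8_koD h hp h5 hM y hb hb')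

/-- The relation `LIII = 0` (i.e. `Gam4(b) = Gam4(b′)`) for the multiplicity function of a Hodge multiset of level `24p`.
[cite: Deligne1982HodgeCycles, Rem. 7.16 (a)] [cite: Aoki1983, Prop. 2.2] -/
private theorem LIII_count_eq_zero (h : Nat.Coprime 24 p) [NeZero (24 * p)] (hp : p.Prime) (h5 : 5 ≤ p)
    {s : Multiset (ZMod (24 * p))} (hs : IsHodgeMultiset s) {b b' : ZMod p} (hb : b ≠ 0) (hb' : b' ≠ 0) :
    LIII h (fun w ↦ (count w s : ℚ)) b b' = 0 := by
  have lin := LIII_linear h b b'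
  exact functional_count_eq_zero hs (fun g ↦ LIII h g b b') lin.1 lin.2.1 (fun t g ↦ lin.2.2.1 t g) lin.2.2.2
    (fun M hM y ↦ LIII_koD h hp h5 hM y hb hb')

/-- The relation `LIV = 0` (i.e. `Gam3(b) = Gam3(b′)`) for the multiplicity function of a Hodge multiset of level `24p`.
[cite: Deligne1982HodgeCycles, Rem. 7.16 (a)] [cite: Aoki1983, Prop. 2.2] -/
private theorem LIV_count_eq_zero (h : Nat.Coprime 24 p) [NeZero (24 * p)] (hp : p.Prime) (h5 : 5 ≤ p)
    {s : Multiset (ZMod (24 * p))} (hs : IsHodgeMultiset s) {b b' : ZMod p} (hb : b ≠ 0) (hb' : b' ≠ 0) :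
    LIV h (fun w ↦ (count w s : ℚ)) b b' = 0 := by
  have lin := LIV_linear h b b'
  exact functional_count_eq_zero hs (fun g ↦ LIV h g b b') lin.1 lin.2.1 (fun t g ↦ lin.2.2.1 t g) lin.2.2.2
    (fun M hM y ↦ LIV_koD h hp h5 hM y hb hb')

/-! ### Public statements -/

/-- The residue of `ℤ/24p` with Chinese-remainder coordinates `(u, c) ∈ ℤ/24 × ℤ/p` (plumbing for the statements below). [folklore] -/
def crtPt24 (h : Nat.Coprime 24 p) (u : ZMod 24) (c : ZMod p) : ZMod (24 * p) := (ZMod.chineseRemainder h).symm (u, c)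

/-- `crtPt24` is the private `pt`. [folklore] -/
private theorem crtPt24_eq (h : Nat.Coprime 24 p) (u : ZMod 24) (c : ZMod p) : crtPt24 h u c = pt h u c := rfl

/-- The odd part of the multiplicity function of a multiset `s` of residues: `ô(w) = #_w(s) − #_{−w}(s)` (an integer). [folklore] -/
def oddCt {n : ℕ} (s : Multiset (ZMod n)) (w : ZMod n) : ℤ := (count w s : ℤ) - count (-w) s

/-- `ĝ` of the multiplicity function is `oddCt`, cast to `ℚ`. [folklore] -/
private theorem hat_count_eq (s : Multiset (ZMod (24 * p))) (w : ZMod (24 * p)) :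
    hat (fun w ↦ (count w s : ℚ)) w = (oddCt s w : ℚ) := by
  simp only [hat, oddCt, Int.cast_sub, Int.cast_natCast]

/-- `Γ_{−8}(b) = U_{χ₋₈}(b) − U_{χ₋₈}(3b) + 2T_{χ₋₈}(3b)` of a multiset `s` of level `24p` (`χ₋₈ = (−2/·)`: `+1` on the units `1,
11, 17, 19`, `−1` on `5, 7, 13, 23`; `T_{χ₋₈}(c) = ô(3,c) + ô(9,c) − ô(15,c) − ô(21,c)`), written out. [folklore] -/
def gammaM8Sum (h : Nat.Coprime 24 p) (s : Multiset (ZMod (24 * p))) (b : ZMod p) : ℤ :=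
    oddCt s (crtPt24 h 1 b) - oddCt s (crtPt24 h 5 b) - oddCt s (crtPt24 h 7 b) + oddCt s (crtPt24 h 11 b)
      - oddCt s (crtPt24 h 13 b) + oddCt s (crtPt24 h 17 b) + oddCt s (crtPt24 h 19 b)
      - oddCt s (crtPt24 h 23 b) - oddCt s (crtPt24 h 1 (3 * b)) + oddCt s (crtPt24 h 5 (3 * b))
      + oddCt s (crtPt24 h 7 (3 * b)) - oddCt s (crtPt24 h 11 (3 * b)) + oddCt s (crtPt24 h 13 (3 * b))
      - oddCt s (crtPt24 h 17 (3 * b)) - oddCt s (crtPt24 h 19 (3 * b)) + oddCt s (crtPt24 h 23 (3 * b))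
      + 2 * oddCt s (crtPt24 h 3 (3 * b)) + 2 * oddCt s (crtPt24 h 9 (3 * b))
      - 2 * oddCt s (crtPt24 h 15 (3 * b)) - 2 * oddCt s (crtPt24 h 21 (3 * b))

/-- `GamM8` of the multiplicity function is `gammaM8Sum`. [folklore] -/
private theorem GamM8_count_eq (h : Nat.Coprime 24 p) (s : Multiset (ZMod (24 * p))) (b : ZMod p) :
    GamM8 h (fun w ↦ (count w s : ℚ)) b = (gammaM8Sum h s b : ℚ) := by
  simp only [GamM8, hat_count_eq, ← crtPt24_eq, gammaM8Sum]
  push_cast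
  ring

/-- `Γ₄(b) = U₄(b) + U₄(3b) + 2E₄(2b) + 2E₄(6b) + 2T₄(3b) + 4S₄(6b)` of a multiset `s` of level `24p` (`χ₄`: `+1` on the units `1,
5, 13, 17`, `−1` on `7, 11, 19, 23`; `E₄(c) = ô(2,c) + ô(10,c) − ô(14,c) − ô(22,c)`, `T₄(c) = ô(3,c) − ô(9,c) + ô(15,c) −
ô(21,c)`, `S₄(c) = ô(6,c) − ô(18,c)`), written out. [folklore] -/
def gamma4Sum (h : Nat.Coprime 24 p) (s : Multiset (ZMod (24 * p))) (b : ZMod p) : ℤ :=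
    oddCt s (crtPt24 h 1 b) + oddCt s (crtPt24 h 5 b) - oddCt s (crtPt24 h 7 b) - oddCt s (crtPt24 h 11 b)
      + oddCt s (crtPt24 h 13 b) + oddCt s (crtPt24 h 17 b) - oddCt s (crtPt24 h 19 b)
      - oddCt s (crtPt24 h 23 b) + oddCt s (crtPt24 h 1 (3 * b)) + oddCt s (crtPt24 h 5 (3 * b))
      - oddCt s (crtPt24 h 7 (3 * b)) - oddCt s (crtPt24 h 11 (3 * b)) + oddCt s (crtPt24 h 13 (3 * b))
      + oddCt s (crtPt24 h 17 (3 * b)) - oddCt s (crtPt24 h 19 (3 * b)) - oddCt s (crtPt24 h 23 (3 * b))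
      + 2 * oddCt s (crtPt24 h 2 (2 * b)) + 2 * oddCt s (crtPt24 h 10 (2 * b))
      - 2 * oddCt s (crtPt24 h 14 (2 * b)) - 2 * oddCt s (crtPt24 h 22 (2 * b))
      + 2 * oddCt s (crtPt24 h 2 (6 * b)) + 2 * oddCt s (crtPt24 h 10 (6 * b))
      - 2 * oddCt s (crtPt24 h 14 (6 * b)) - 2 * oddCt s (crtPt24 h 22 (6 * b))
      + 2 * oddCt s (crtPt24 h 3 (3 * b)) - 2 * oddCt s (crtPt24 h 9 (3 * b))
      + 2 * oddCt s (crtPt24 h 15 (3 * b)) - 2 * oddCt s (crtPt24 h 21 (3 * b))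
      + 4 * oddCt s (crtPt24 h 6 (6 * b)) - 4 * oddCt s (crtPt24 h 18 (6 * b))

/-- `Gam4` of the multiplicity function is `gamma4Sum`. [folklore] -/
private theorem Gam4_count_eq (h : Nat.Coprime 24 p) (s : Multiset (ZMod (24 * p))) (b : ZMod p) :
    Gam4 h (fun w ↦ (count w s : ℚ)) b = (gamma4Sum h s b : ℚ) := by
  simp only [Gam4, hat_count_eq, ← crtPt24_eq, gamma4Sum]
  push_cast
  ring

/-- `Γ₃(b) = U₃(b) + U₃(2b) + 2E₃(2b) + 2E₃(4b) + 4Q₃(4b) + 4Q₃(8b) + 4O₃(8b)` of a multiset `s` of level `24p` (`χ₃`: `+1` on the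
units `1, 7, 13, 19`, `−1` on `5, 11, 17, 23`; `E₃(c) = ô(2,c) − ô(10,c) + ô(14,c) − ô(22,c)`, `Q₃(c) = ô(4,c) − ô(20,c)`, `O₃(c)
= ô(8,c) − ô(16,c)`), written out. [folklore] -/
def gamma3Sum (h : Nat.Coprime 24 p) (s : Multiset (ZMod (24 * p))) (b : ZMod p) : ℤ :=
    oddCt s (crtPt24 h 1 b) - oddCt s (crtPt24 h 5 b) + oddCt s (crtPt24 h 7 b) - oddCt s (crtPt24 h 11 b)
      + oddCt s (crtPt24 h 13 b) - oddCt s (crtPt24 h 17 b) + oddCt s (crtPt24 h 19 b)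
      - oddCt s (crtPt24 h 23 b) + oddCt s (crtPt24 h 1 (2 * b)) - oddCt s (crtPt24 h 5 (2 * b))
      + oddCt s (crtPt24 h 7 (2 * b)) - oddCt s (crtPt24 h 11 (2 * b)) + oddCt s (crtPt24 h 13 (2 * b))
      - oddCt s (crtPt24 h 17 (2 * b)) + oddCt s (crtPt24 h 19 (2 * b)) - oddCt s (crtPt24 h 23 (2 * b))
      + 2 * oddCt s (crtPt24 h 2 (2 * b)) - 2 * oddCt s (crtPt24 h 10 (2 * b))
      + 2 * oddCt s (crtPt24 h 14 (2 * b)) - 2 * oddCt s (crtPt24 h 22 (2 * b))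
      + 2 * oddCt s (crtPt24 h 2 (4 * b)) - 2 * oddCt s (crtPt24 h 10 (4 * b))
      + 2 * oddCt s (crtPt24 h 14 (4 * b)) - 2 * oddCt s (crtPt24 h 22 (4 * b))
      + 4 * oddCt s (crtPt24 h 4 (4 * b)) - 4 * oddCt s (crtPt24 h 20 (4 * b))
      + 4 * oddCt s (crtPt24 h 4 (8 * b)) - 4 * oddCt s (crtPt24 h 20 (8 * b))
      + 4 * oddCt s (crtPt24 h 8 (8 * b)) - 4 * oddCt s (crtPt24 h 16 (8 * b))

/-- `Gam3` of the multiplicity function is `gamma3Sum`. [folklore] -/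
private theorem Gam3_count_eq (h : Nat.Coprime 24 p) (s : Multiset (ZMod (24 * p))) (b : ZMod p) :
    Gam3 h (fun w ↦ (count w s : ℚ)) b = (gamma3Sum h s b : ℚ) := by
  simp only [Gam3, hat_count_eq, ← crtPt24_eq, gamma3Sum]
  push_cast
  ring

/-- **Koblitz–Ogus relation of the character `ψ = χ₃χ₋₈` at level `24p`.** For every Hodge multiset `s` of level `24p`,
`p ≥ 5` prime, and every `b ≢ 0 (mod p)`, with `ô(u, b) = #_{(u,b)}(s) − #_{(−u,−b)}(s)` in the coordinates `ℤ/24p ≅ ℤ/24 × ℤ/p`: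
`ô(1,b) + ô(5,b) − ô(7,b) − ô(11,b) − ô(13,b) − ô(17,b) + ô(19,b) + ô(23,b) = 0`.
[cite: Deligne1982HodgeCycles, Rem. 7.16 (a)] [cite: Aoki1983, Prop. 2.2] [cite: Shioda1982PicardFermat, §3 p. 727] -/
theorem relPsi_twentyFourPrime [NeZero (24 * p)] (hp : p.Prime) (h5 : 5 ≤ p) (h : Nat.Coprime 24 p)
    {s : Multiset (ZMod (24 * p))} (hs : IsHodgeMultiset s) {b : ZMod p} (hb : b ≠ 0) :
    oddCt s (crtPt24 h 1 b) + oddCt s (crtPt24 h 5 b) - oddCt s (crtPt24 h 7 b) - oddCt s (crtPt24 h 11 b)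
      - oddCt s (crtPt24 h 13 b) - oddCt s (crtPt24 h 17 b) + oddCt s (crtPt24 h 19 b)
      + oddCt s (crtPt24 h 23 b) = 0 := by
  have key := LPsi_count_eq_zero h hp h5 hs hb
  simp only [LPsi, hat_count_eq, ← crtPt24_eq] at key
  exact_mod_cast key

/-- **Koblitz–Ogus relation of the character `χ₈ = (2/·)` at level `24p`** (`p ≥ 5` prime, `b ≢ 0`):
`U_{χ₈}(b) + U_{χ₈}(3b) + 2T_{χ₈}(3b) = 0`, i.e. with `χ₈ = +1` on the units `1, 7, 17, 23` and `−1` on `5, 11, 13, 19`,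
`Σ_u χ₈(u) ô(u,b) + Σ_u χ₈(u) ô(u,3b) + 2(ô(3,3b) − ô(9,3b) − ô(15,3b) + ô(21,3b)) = 0`.
[cite: Deligne1982HodgeCycles, Rem. 7.16 (a)] [cite: Aoki1983, Prop. 2.2] [cite: Shioda1982PicardFermat, §3 p. 727] -/
theorem relChi8_twentyFourPrime [NeZero (24 * p)] (hp : p.Prime) (h5 : 5 ≤ p) (h : Nat.Coprime 24 p)
    {s : Multiset (ZMod (24 * p))} (hs : IsHodgeMultiset s) {b : ZMod p} (hb : b ≠ 0) :
    oddCt s (crtPt24 h 1 b) - oddCt s (crtPt24 h 5 b) + oddCt s (crtPt24 h 7 b) - oddCt s (crtPt24 h 11 b)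
      - oddCt s (crtPt24 h 13 b) + oddCt s (crtPt24 h 17 b) - oddCt s (crtPt24 h 19 b)
      + oddCt s (crtPt24 h 23 b) + oddCt s (crtPt24 h 1 (3 * b)) - oddCt s (crtPt24 h 5 (3 * b))
      + oddCt s (crtPt24 h 7 (3 * b)) - oddCt s (crtPt24 h 11 (3 * b)) - oddCt s (crtPt24 h 13 (3 * b))
      + oddCt s (crtPt24 h 17 (3 * b)) - oddCt s (crtPt24 h 19 (3 * b)) + oddCt s (crtPt24 h 23 (3 * b))
      + 2 * oddCt s (crtPt24 h 3 (3 * b)) - 2 * oddCt s (crtPt24 h 9 (3 * b))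
      - 2 * oddCt s (crtPt24 h 15 (3 * b)) + 2 * oddCt s (crtPt24 h 21 (3 * b)) = 0 := by
  have key := LChi8_count_eq_zero h hp h5 hs hb
  simp only [LChi8, hat_count_eq, ← crtPt24_eq] at key
  have key' : ((
      oddCt s (crtPt24 h 1 b) - oddCt s (crtPt24 h 5 b) + oddCt s (crtPt24 h 7 b) - oddCt s (crtPt24 h 11 b)
        - oddCt s (crtPt24 h 13 b) + oddCt s (crtPt24 h 17 b) - oddCt s (crtPt24 h 19 b)
        + oddCt s (crtPt24 h 23 b) + oddCt s (crtPt24 h 1 (3 * b)) - oddCt s (crtPt24 h 5 (3 * b))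
        + oddCt s (crtPt24 h 7 (3 * b)) - oddCt s (crtPt24 h 11 (3 * b)) - oddCt s (crtPt24 h 13 (3 * b))
        + oddCt s (crtPt24 h 17 (3 * b)) - oddCt s (crtPt24 h 19 (3 * b)) + oddCt s (crtPt24 h 23 (3 * b))
        + 2 * oddCt s (crtPt24 h 3 (3 * b)) - 2 * oddCt s (crtPt24 h 9 (3 * b))
        - 2 * oddCt s (crtPt24 h 15 (3 * b)) + 2 * oddCt s (crtPt24 h 21 (3 * b)) : ℤ) : ℚ) = 0 := by
    push_cast
    linear_combination key
  exact_mod_cast key'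

/-- **Koblitz–Ogus relation of the odd character `χ₋₈ = (−2/·)` at level `24p`** (`p ≥ 5` prime): `Γ_{−8}(b) = Γ_{−8}(b′)` for all `b, b′ ≢ 0 (mod p)` (`gammaM8Sum`).
[cite: Deligne1982HodgeCycles, Rem. 7.16 (a)] [cite: Aoki1983, Prop. 2.2] [cite: Shioda1982PicardFermat, §3 p. 727] -/
theorem gammaChiM8_twentyFourPrime [NeZero (24 * p)] (hp : p.Prime) (h5 : 5 ≤ p) (h : Nat.Coprime 24 p)
    {s : Multiset (ZMod (24 * p))} (hs : IsHodgeMultiset s) {b b' : ZMod p} (hb : b ≠ 0) (hb' : b' ≠ 0) :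
    gammaM8Sum h s b = gammaM8Sum h s b' := by
  have key := LM8_count_eq_zero h hp h5 hs hb hb'
  rw [LM8, GamM8_count_eq, GamM8_count_eq, sub_eq_zero] at key
  exact_mod_cast key

/-- **Koblitz–Ogus relation of the odd character `χ₄` at level `24p`** (`p ≥ 5` prime): `Γ₄(b) = Γ₄(b′)` for all `b, b′ ≢ 0 (mod p)` (`gamma4Sum`).
[cite: Deligne1982HodgeCycles, Rem. 7.16 (a)] [cite: Aoki1983, Prop. 2.2] [cite: Shioda1982PicardFermat, §3 p. 727] -/
theorem gammaChi4_twentyFourPrime [NeZero (24 * p)] (hp : p.Prime) (h5 : 5 ≤ p) (h : Nat.Coprime 24 p)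
    {s : Multiset (ZMod (24 * p))} (hs : IsHodgeMultiset s) {b b' : ZMod p} (hb : b ≠ 0) (hb' : b' ≠ 0) :
    gamma4Sum h s b = gamma4Sum h s b' := by
  have key := LIII_count_eq_zero h hp h5 hs hb hb'
  rw [LIII, Gam4_count_eq, Gam4_count_eq, sub_eq_zero] at key
  exact_mod_cast key

/-- **Koblitz–Ogus relation of the odd character `χ₃` at level `24p`** (`p ≥ 5` prime): `Γ₃(b) = Γ₃(b′)` for all `b, b′ ≢ 0 (mod p)` (`gamma3Sum`).
[cite: Deligne1982HodgeCycles, Rem. 7.16 (a)] [cite: Aoki1983, Prop. 2.2] [cite: Shioda1982PicardFermat, §3 p. 727] -/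
theorem gammaChi3_twentyFourPrime [NeZero (24 * p)] (hp : p.Prime) (h5 : 5 ≤ p) (h : Nat.Coprime 24 p)
    {s : Multiset (ZMod (24 * p))} (hs : IsHodgeMultiset s) {b b' : ZMod p} (hb : b ≠ 0) (hb' : b' ≠ 0) :
    gamma3Sum h s b = gamma3Sum h s b' := by
  have key := LIV_count_eq_zero h hp h5 hs hb hb'
  rw [LIV, Gam3_count_eq, Gam3_count_eq, sub_eq_zero] at key
  exact_mod_cast key

end TwentyFourPrime

end Literature.AlgebraicGeometry.Shioda1982
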